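import Literature.MathematicalPhysics.QuantumFieldTheory.Balaban1983to89.Beta.TransportedContourVariables
import Literature.MathematicalPhysics.QuantumFieldTheory.Balaban1983to89.Beta.OneStepResolventKernel

/-!
# `Balaban1983to89.Beta.AveragingHessianKernels` — the SECOND-ORDER KERNELS of Bałaban's one-step covariant
# averaging (15) at the trivial background `U = 1`: the first-jet kernel `q¹_b`, the W-Hessian kernel `h_b`
# ((b2)), the field–multiplier ((V-H)) kernel `m_b` in the product chart ((b1)), their packing into an2's
# `LocStencil` / `BiLoc` sockets, the (1.11) overlap multiplicities ((b3)) and the composite-jet chain rule ((b4)), v1.0.1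

HONEST FRAMING (page 1, mandatory).  This leaf belongs to the β sub-cell of the Bałaban audit, whose END STATEMENT is:
discharging the one-loop hypothesis `FlowStep.BetaPertH` (read at END-STATEMENT grade, RULING (R6)) makes Bałaban's
ultraviolet stability theorem for 4-d lattice Yang–Mills ([Balaban1989LargeFieldII], Thm. 1 p. 355 (B16))
UNCONDITIONAL inside this package — a real constructive-QFT result; it is NOT the continuum limit and NOT the Clay
problem.  Gloss 2: EVERYTHING below is kernel-proved [folklore] algebra of finite letter lists, finite sums on `ℤ^d`
and elementary real estimates; NOTHING is cited as a fact.  [Balaban1985Averaging] (= B7, CMP 98 (1985) 17–51),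
[Balaban1985BackgroundPropagators] (= B9, CMP 99 (1985) 389–434) and [Balaban1984PropagatorsI] (= B5-I, CMP 95 (1984)
17–40) are quoted only to say WHICH objects are being typed; the manuscripts under audit are not citable for their
disputed steps and no programme-internal claim enters.

ABSOLUTE RULE (cell charter, verbatim; header line added v1.0.2 per beta-ref advisory A-R371, docstring-only): «No
internally-minted statement may enter as a cited fact. Every hypothesis is either kernel-proved in this package or a
verbatim quotation of a PUBLISHED theorem with page reference. The manuscript(s) under audit are NOT citable for their
own disputed steps — they are the thing under adjudication; programme-internal (2001/route/tribunal) claims are never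
citable.»  Accordingly NO declaration below is a `def … : Prop` carrying a citation and no hypothesis of any theorem is
a printed statement: every declaration is [folklore]; the quotations are object LOCATORS only.

THE PRINTED OBJECTS (locators, verbatim; re-read for this module as page images, 2026-08-19, from the renders
`b2b-balaban-ref1/pages/1985-cmp98-averaging/1985-cmp98-averaging-p003/p004-x2.png` = B7 pp.19–20 (journal page = PDF
page + 16) and `…/1985-cmp99-background-propagators/…-p004/p005-x2.png` = B9 pp.392–393 (journal page = PDF page + 388);
the contour quotations B5-I (1.6)–(1.11), B7 p.19 (14) «Γ_{c,x}», p.24 «Γ_{y,x}», p.25 (46)ff are those of node 5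
`Beta.AveragingContours` (header, XREAD-verified), whose letter lists are used BY NAME).
* B7 p.19: «For such configurations we demand that (1/i) log Ū is well approximated by the linear averaging operation
  (1.8) defined in [2]. Let us write this operation Ā_c = Σ_{x∈B(c_−)} L^{−(d+1)}(A(Γ_{c_−,x}) + A([x, x(c)]) +
  A(Γ_{x(c),c_+})). (14)», «Let us notice that Γ_{c_−,x}∪[x, x(c)]∪Γ_{x(c),c_+} is an oriented contour with c_− as an
  initial point and c_+ as a final point. We denote it by Γ_{c,x}.», «We define Ū_c = exp[i Σ_{x∈B(c_−)} L^{−d} (1/i)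
  log U(Γ_{c,x})U(c)^{−1}] U(c). (15)» (the same display is (42) of Sect. B, p.23); (11) «(Ū^u)(y, y′) =
  u(y)Ū(y, y′)u^{−1}(y′), or Ū^u = (Ū)^u.»; p.20: «It is easy to see that taking U = e^{iA} with A small and expanding
  the logarithm of the expression on the right-hand side above in powers of A, we get the expression (14) as a linear
  term in the expansion.», «In this paper we will study properties of this and other averaging operations, and
  especially their compositions.», «Another important property is an analyticity of a result of the averaging
  operation with respect to an averaged field.»
* B9 p.392 (3.12) «A^η(exp iηAU) = A^η(U) + ⟨A, J⟩ + ½⟨A, ΔA⟩ + ⋯» (the fluctuation multiplies the background on the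
  LEFT), (3.13) «Q_j(U, ηA) = (1/i) log (exp iηA)‾‾^j» with «the averaging operation used here is the operation Ū^j
  [double bar] defined by the formulas (89)–(92) of that paper. We replace U₀ by U in these definitions»; p.393 (3.14)
  «(1/(L^jη)) Q_j(U, ηA) = Q_j(U)A + (1/(L^jη)) C_j(U, L^jηA), where Q_j(U)A is a linear part of the function (3.13) and
  C_j(U, A) is an analytic function of A whose expansion begins with second order terms. We are interested in the linear
  operators Q_j(U). They are compositions of j one-step averaging operators Q_j(U) = Q(Ū^{j−1})·…·Q(Ū)Q(U), (3.15)
  where Q(V) is given by the explicit formula (124) in [5].»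
* B5-I p.19 (1.11) «(QA)_c = Σ_{x∈B(c_−)} L^{−(d+1)} A([x, x(c)])» (node 5 header; an2's `AffineAveraging.contourSum`).
Nothing printed is asserted.  In particular this module does NOT claim that its letter functionals ARE the jets of (15):
that identification (log-free, along one-parameter rays, over any complete normed algebra, in the manner of node 4b
`Beta.LogHolonomySecondJet`) is the sequel leaf `Beta.AveragingHessianJets` (node 7b).  What is typed HERE is the
algebra, the combinatorics and the packaging of three explicitly defined functionals of a pair of lattice one-forms,
and the EXACT dictionary between them.

THE CONSUMER'S REQUEST (an2-g8, journal 2026-08-19T12:58:03Z item (B), verbatim): «the ONE-step averaging second jet at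
U = 1 as kernels in the OSRK index types — (b1) the field–multiplier blocks `Q″[e_{(u,κ′)}, ·]` (the (V-H) stencil: for
each fine bond (u,κ′) the `MKer` with entries on (inl α, inr b)/(inr b, inl α)), (b2) the ff-kernel `Q_b″` per coarse
bond b (needed for the NEW item P3d …), (b3) a word on `(Q′Q′ᵀ)` at U = 1 for the (1.11) average …, (b4) for `Jc m`: the
COMPOSITE (hierarchical) second jets, or just the recursion `Q_m″[a,b] = Q″[Q_{m−1}′a, Q_{m−1}′b] + Q′·Q_{m−1}″[a,b]`
typed once».

WHAT IS TYPED (letters colour-free: `𝔸` any ring, later any normed ring; a lattice one-form is node 5's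
`Form1 d 𝔸 = Fin d → (Fin d → ℤ) → 𝔸`, backward bonds read with a sign by node 5's lists; the coarse bond is
`b = (μ, y)`, its fine image the straight segment `c` of `L` bonds from `L·y` (node 5 `segUp _ (L•y) μ L`), its
contours `Γ_{b,x}` = `gammaC`, the closed loops `Γ_{b,x} ∪ (−c)` = `loopC`, `x = L·y + b′`, `b′ ∈ box d L`).  Write
`Φ_b` for the map (15) `U ↦ Ū_b` and, for one-forms `W` (FLUCTUATION, always the FIRST slot) and `B` (BACKGROUND,
always the SECOND slot) with values in `𝔸`:
  `Z₁(X)   := L^{−d}·linAvg X`                                   (the letter sum of (14), node 5, `= L·Ā_b`),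
  `H_b(W, W′) := (hessU W W′ L μ y)/(2L^d)`,  `hessU` := `Σ_{x} cross(loop_x) + ([linAvg W, W′(c)] + [linAvg W′, W(c)])
              + L^d·cross(c)`,  `cross(ℓ; W, W′) := Σ_{i<j} ([W_i, W′_j] + [W′_i, W_j])` along the letter PAIRS of `ℓ`
              (§1; the polarisation of an2's `commSum`: `cross_diag`),
  `M_b(W; B) := (vhU W B L μ y)/(2L^{2d})`,  `vhU := L^d·hessU W B + L^d·linAvg [W, B]_bw − [linAvg W, linAvg B]`,
              `[W, B]_bw` the one-form `f ↦ [W_f, B_f]` (`bw`),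
— the letter-level candidates (node 7b proves: the values) of, respectively, the first jet of `r ↦ log Φ_b(e^{rX})`,
the W-HESSIAN `∂_s∂_{s′}|₀ log Φ_b(e^{sW + s′W′})` (an2's (b2): the Hessian of the constraint that the multiplier
consumes at `U = 1`), and THE (V-H) STENCIL IN THE PRODUCT CHART `∂_s∂_t|₀ log[Φ_b(e^{sW}e^{tB})·Φ_b(e^{tB})⁻¹]`
(an2's (b1) when the bordered operator is differentiated in the chart `U = e^{W}e^{B}` of B9 (3.12)/(3.13) and of an3's
(V-V) jets `PlaquetteVertex.jet21`; B7 p.28 names the same right-trivialised function «(1/i) log (V′V₀)‾_c(V̄₀)_c^{−1}»).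
THE DICTIONARY between the two second-order objects is an IDENTITY OF DEFINITIONS here (`vhU` unfolds to it):
  `M_b(W; B) = H_b(W, B) + ½·Z₁([W, B]_bw) − ½·[Z₁W, Z₁B]`
(first extra term: the same-bond BCH contact `e^{sW_f}e^{tB_f} = exp(sW_f + tB_f + ½st[W_f, B_f] + …)`, read WITH
ORIENTATION — a backward bond carries `(e^{sW_f}e^{tB_f})⁻¹`, which is why `[W, B]_bw` enters as a ONE-FORM through
`linAvg` and not as the commutator of negated letters; second: the right re-centring by `Φ_b(e^{tB})⁻¹`).  So (b1) is
the partial evaluation of (b2) ONLY in an additive chart `U = e^{W+B}`; both packings are delivered (`vhS` product,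
`vhSadd` additive) and an2 decides which his `JetData.S` is.
§1–§2 (`PairAlgebra`, `Functionals`): `comm`, `cross`, `diag`, `wedge` (the scalar shadow of `cross` over a
   commutative ring), their swap/append/vanishing laws, `cross_diag : cross (b, b)_list = 2 • commSum`, the bridge
   `cross (l.map (smulPair w w′)) = wedge l • comm w w′`; the functionals `hessU`, `vhU` and `hessU_symm`.
§3 (`Kernels`) THE INTEGER COUNT KERNELS on fine-bond pairs (`Bond d = Fin d × (Fin d → ℤ)`): `linCount`, `cCount`,
   `hessCount`, `vhCount`, with the SINGLE-BOND IDENTIFICATION THEOREMS `linAvg_single : linAvg (single f w) = linCount • w`,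
   `hessU_single : hessU (single f w) (single f′ w′) = hessCount f f′ • comm w w′`,
   `vhU_single : vhU (single f w) (single f′ v) = vhCount f f′ • comm w v` (so, by biadditivity, `2L^d·H_b(W, W′) =
   Σ_{f,f′} hessCount_b(f, f′)·[W_f, W′_{f′}]` etc. for finitely supported forms — the kernels ARE the coefficients of
   the commutators; ad-type colour structure), `hessCount_swap` (ANTISYMMETRY — what makes the physical Hessian
   symmetric), `hessCount_self`, and the closed form `vhCount = L^d·hessCount + L^d·δ_{ff′}·linCount − linCount ⊗ linCount`.
§4 (`Support`) FINITE RANGE: all kernels of `b = (μ, y)` vanish unless both bonds start in the box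
   `Near L y = Π_i [L·y_i, L·y_i + 2L − 1]` (`linCount_eq_zero`, `hessCount_eq_zero_left/right`, `vhCount_eq_zero_left/right`;
   mechanism: every letter of `gammaC`/`loopC`/`c` is a value `±A κ x` with `x` there — `lettersIn_loopC`, `lettersIn_cSeg`).
§5 (`Bounds`) `|linCount| ≤ L^d·ℓ`, `|cCount| ≤ L`, `|hessCount| ≤ 4L^d·ℓ²`, `|vhCount| ≤ 6L^{2d}·ℓ²`, `ℓ = ell d L = (2d+2)L`
   (node 5 `loopC_length_le`); crude but explicit.
§6 (`Covariance`) BLOCK-translation covariance `kernel_{(μ, y+t)}(f + L·t, f′ + L·t) = kernel_{(μ,y)}(f, f′)`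
   (`linCount_add`, `hessCount_add`, `vhCount_add`; node 5 `loopC_add`/`linAvg_add`/`segUp_add`).  NOT invariant under all
   fine translations.
§7 (`RealKernels`) `linKer = linCount/L^d`, `hessKer = hessCount/(2L^d)`, `vhKer = vhCount/(2L^{2d})` with
   `|hessKer| ≤ 2ℓ²`, `|vhKer| ≤ 3ℓ²`, `|linKer| ≤ ℓ`, antisymmetry, support, covariance.
§8 (`Packing`) INTO an2's SOCKETS (`OneStepResolventKernel.Fib d = Fin (d+1) ⊕ Fin (d+1)`, `ExpKernelCalculus.MKer`,
   node-5 objects taken in dimension `d+1`): the generic packer `packVH K L κ′ u` of a per-coarse-bond kernel family into a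
   STENCIL FAMILY indexed by the background fine bond `(κ′, u)` — entry `((x, inl α), (z, inr μ)) = K μ (z/L) (α, x) (κ′, u)`
   if `z ∈ L·ℤ^{d+1}` (the fine image of the coarse site; node 5 `off`/`blk`), the symmetric twin on `(inr, inl)`, `0` on
   the diagonal blocks —, `packVH_symm`, **`locStencil_packVH`**: supported + bounded by `C` ⇒ `LocStencil (packVH K L)
   (C·e^{4(d+1)Lδ}) δ` for EVERY `δ ≥ 0`, and **`packVH_translate`**: `packVH K L κ′ (u + L·t) = shiftK (−L·t) (packVH K L κ′ u)`
   (the instance `v = L·t` of `OneStepResolventKernel.vertexOf_translate`'s hypothesis `hS` — the only instance the proof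
   of `OneStepKernelFamily.vertexOfK_translate` uses; the full-`v` hypothesis is FALSE for averaging stencils).  Then
   (b1) `vhS d L := packVH vhKer`, (b1′) `vhSadd d L := packVH hessKer` with `locStencil_vhS` (constant `3ℓ²e^{4(d+1)Lδ}`,
   `ℓ = (2d+4)L`), `locStencil_vhSadd` (`2ℓ²e^{…}`), `vhS_translate`, `vhSadd_translate`, `vhS_symm`; and (b2)
   `hessFF L μ y` = `h_{(μ,y)}` on the `(inl, inl)` block, `hessFF_antisymm`, **`biLoc_hessFF`**: `BiLoc (hessFF L μ y) (L·y)
   (L·y) (2ℓ²e^{4(d+1)Lδ}) δ`, `hessFF_translate`.  SLOTS: in `vhS d L κ′ u x z (inl α) (inr μ)` the FAMILY index `(κ′, u)`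
   is the BACKGROUND fine bond (the one the bordered operator is differentiated against), `(α, x)` the FLUCTUATION field
   component, `(μ, z/L)` the coarse bond of the multiplier; the value is `m_{(μ, z/L)}((α, x), (κ′, u))`.
§9 (`Straight`) (b3): the multiplicity `straightCount L μ y f = #{x ∈ B(y) : f ⊂ [x, x + Le_μ]}` (`= straightSum (δ1 f)`,
   node 5), so the (1.11) matrix is `Q′[b, f] = L^{−(d+1)}·c_b(f)`; direction selection, `0 ≤ c ≤ L^d·L`, block covariance,
   and DECIDED overlap profiles in `d = 1`: `L = 2 ↦ (1, 2, 1, 0)`, `L = 3 ↦ (1, 2, 3, 2, 1, 0)` along the block line —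
   the straight families of one coarse bond OVERLAP and reach into the `μ`-neighbour block.  THE WORD an2 asked for
   (recorded, with the general closed form NOT kernel-proved beyond the decided instances): `c_L(s) = min(s+1, 2L−1−s)`,
   `Σ_f c_b(f)² = L^{d−1}·L(2L²+1)/3`, `Σ_f c_b c_{b±e_μ} = L^{d−1}·(L−1)L(L+1)/6`, all other pairs `0`; hence
   `Q′Q′ᵀ = L^{−(d+2)}·[((2L²+1)/3)·𝟙 + ((L²−1)/6)·(T_μ + T_μ⁻¹)]` on `μ`-bonds (node-5 dimension `d`): block-diagonal in
   `μ`, translation-invariant, three-point along `μ`, symbol `≥ L^{−(d+2)}(L²+2)/3 > 0`; `= L^{−(d+1)}𝟙` only for `L = 1`.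
§10 (`Composite`) (b4): second-order jets `Jet2 V W = (lin : V →+ W, bil : V → V → W)`, the chain rule `Jet2.comp`
   (`(Φ∘Ψ)″[a,b] = Φ″[Ψ′a, Ψ′b] + Φ′(Ψ″[a,b])`), its associativity, the m-fold composite `Jet2.iter` with THE RECURSION
   `iter_succ_bil` verbatim as requested and the unrolled form `iter_bil_eq_sum`
   `Q_m″[a,b] = Σ_{j<m} (Φ_{m−1}′⋯Φ_{j+1}′)·Φ_j″[Q_j′a, Q_j′b]` (B9 (3.15) is the first-jet half `Q_j = Q(Ū^{j−1})⋯Q(U)`).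
§11 (`Toy`) DECIDED tables certifying signs, slots and normalisations: `L = 1` (everything `0` but `q¹ = δ_c`) and
   `d = 1, L = 2` (`q¹ = δ_{c₀} + δ_{c₁}`, i.e. `Z₁X = X_{c₀} + X_{c₁}` — B7's (14)-normalised `Ā_b = q¹/L` is `½` on each —,
   `h(c₀, c₁) = ½ = −h(c₁, c₀)`, `m(c₁, c₀) = −1`, all else `0`: `Φ_b(U) =
   U_{c₀}U_{c₁}`, `H(W, W′) = ½([W_{c₀}, W′_{c₁}] + [W′_{c₀}, W_{c₁}])`, `M(W; B) = [B_{c₀}, W_{c₁}]` = the `t`-derivative of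
   `Ad_{e^{tB_{c₀}}}W_{c₁}` — node 6's transport picture).

COLOUR (for an2's `C := PUnit` stripping).  Every kernel here is the coefficient of a COMMUTATOR `[W_f, X_{f′}]`; the
physical colour matrix is `kernel(f, f′)·(structure constants)`, as an3's background letter enters through `adM` in
`PlaquetteBackground.actionJet21_eq_wilsonVertexOp`; `hessKer`'s antisymmetry in `(f, f′)` is what makes `H_b` symmetric.

WHAT IS NOT TYPED HERE (scope; Edison census).  (i) The matching theorems «`Z₁`, `H_b`, `M_b` ARE the jets of (15)»
(node 7b `Beta.AveragingHessianJets`: a 2-jet-at-0 calculus generalising node 4b's `log_holPath_jets`, the BCH contact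
and the re-centring along rays `r ↦ e^{rσW}e^{rτB}`).  (ii) The (89)–(92) dressing of B9 (3.13) (`R(U₀)`-frames) and the
BCH-dressed correction terms of (124): their FIRST-order `B`-jets are node 4 `Beta.AveragingCorrectionJets`; whether
an2's bordered operator is differentiated in the product or the additive chart is an2's decision (both served).
(iii) Sharp constants (the true range is `≤ 2` blocks and `|h| ≤ O(L)`), the general closed forms of `c_L` and of the
tree-contour (14) Gram (node 5 `linAvg_eq_straight_sub_grad`: (14) = (1.11) − coarse gradient, so its Gram has the same
two overlaps plus tree parts; diagonal only in `d = 1`), second-order gauge laws of `h`/`m`.  (iv) Anything about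
`BetaPertH` itself: this is ONE INPUT of an2's P3b/P3d vertices, by name.  NOT summit progress; NOT continuum; NOT Clay.

PROVENANCE.  v1 (gen 11, seat `b2b-balaban-beta-an1-g11`): p188755 (29a530a43ca2).  v1.0.1 (same day): DOCSTRING-ONLY —
the two toy-table glosses of `q¹` (the §11 summary above and the §11 module docstring) corrected from «½» to `1`
(`q¹ := linCount/L^d = linKer`, so `Z₁X = X_{c₀} + X_{c₁}` in the `d = 1, L = 2` toy, as the dictionary
`m(c₁,c₀) = h(c₁,c₀) − ½q¹(c₁)q¹(c₀) = −½ − ½ = −1` requires; the «½» is B7's (14)-normalised `Ā_b = q¹/L`), per the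
XREAD of v1 (lit3-g20, «ok (CONSISTENT) 0∣0∣0∣0, DOCFIX 1 LOW», GAPS C-lit3g20-4); no declaration changed.
-/


namespace Literature.MathematicalPhysics.QuantumFieldTheory.Balaban1983to89.Beta.AveragingHessianKernels

open Finset
open Literature.MathematicalPhysics.QuantumFieldTheory.Balaban1983to89.Beta.TransportVertices (commSum commSum_nil commSum_cons)
open Literature.MathematicalPhysics.QuantumFieldTheory.Balaban1983to89.Beta.AffineAveraging
open Literature.MathematicalPhysics.QuantumFieldTheory.Balaban1983to89.Beta.AveragingContours
open Literature.MathematicalPhysics.QuantumFieldTheory.Balaban1983to89.Beta.TransportedContourVariables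

/-! ## §1 Pair-list algebra -/

section PairAlgebra

variable {𝔸 : Type*} [Ring 𝔸]

/-- [folklore] The commutator `[a, b] = ab − ba`. -/
def comm (a b : 𝔸) : 𝔸 := a * b - b * a

/-- [folklore] `[a, a] = 0`. -/
@[simp] theorem comm_self (a : 𝔸) : comm a a = 0 := by simp [comm]

/-- [folklore] `[b, a] = −[a, b]`. -/
theorem comm_anticomm (a b : 𝔸) : comm b a = -comm a b := by simp [comm]

/-- [folklore] `[0, a] = 0`. -/
@[simp] theorem comm_zero_left (a : 𝔸) : comm 0 a = 0 := by simp [comm]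

/-- [folklore] `[a, 0] = 0`. -/
@[simp] theorem comm_zero_right (a : 𝔸) : comm a 0 = 0 := by simp [comm]

/-- [folklore] Additivity of `[·, c]`. -/
theorem comm_add_left (a b c : 𝔸) : comm (a + b) c = comm a c + comm b c := by
  simp only [comm]; noncomm_ring

/-- [folklore] Additivity of `[a, ·]`. -/
theorem comm_add_right (a b c : 𝔸) : comm a (b + c) = comm a b + comm a c := by
  simp only [comm]; noncomm_ring

/-- [folklore] `[−a, b] = −[a, b]`. -/
theorem comm_neg_left (a b : 𝔸) : comm (-a) b = -comm a b := by simp only [comm]; noncomm_ring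

/-- [folklore] `[a, −b] = −[a, b]`. -/
theorem comm_neg_right (a b : 𝔸) : comm a (-b) = -comm a b := by simp only [comm]; noncomm_ring

/-- [folklore] `[a − b, c] = [a, c] − [b, c]`. -/
theorem comm_sub_left (a b c : 𝔸) : comm (a - b) c = comm a c - comm b c := by
  simp only [comm]; noncomm_ring

/-- [folklore] `[a, b − c] = [a, b] − [a, c]`. -/
theorem comm_sub_right (a b c : 𝔸) : comm a (b - c) = comm a b - comm a c := by
  simp only [comm]; noncomm_ring

/-- [folklore] Integer scalars pull out of a commutator: `[n•w, m•v] = (nm)•[w, v]`. -/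
theorem comm_zsmul_zsmul (n m : ℤ) (w v : 𝔸) : comm (n • w) (m • v) = (n * m) • comm w v := by
  simp only [comm, smul_mul_smul_comm, smul_sub, mul_comm m n]

/-- [folklore] THE POLARISED COMMUTATOR SUM along a list of letter PAIRS `[(a₁,b₁),…,(a_n,b_n)]`:
`cross l = Σ_{i<j} ([a_i, b_j] + [b_i, a_j])` — the mixed second-order term of `commSum (a + b)`. -/
def cross : List (𝔸 × 𝔸) → 𝔸
  | [] => 0
  | p :: l => cross l + (comm p.1 (fl l).sum + comm p.2 (bg l).sum)

/-- [folklore] `cross [] = 0`. -/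
@[simp] theorem cross_nil : cross ([] : List (𝔸 × 𝔸)) = 0 := rfl

/-- [folklore] The recursion of `cross`. -/
@[simp] theorem cross_cons (p : 𝔸 × 𝔸) (l : List (𝔸 × 𝔸)) :
    cross (p :: l) = cross l + (comm p.1 (fl l).sum + comm p.2 (bg l).sum) := rfl

/-- [folklore] THE DIAGONAL (same-position) COMMUTATOR SUM `diag l = Σ_i [a_i, b_i]`. -/
def diag (l : List (𝔸 × 𝔸)) : 𝔸 := (l.map fun p => comm p.1 p.2).sum

/-- [folklore] `diag [] = 0`. -/
@[simp] theorem diag_nil : diag ([] : List (𝔸 × 𝔸)) = 0 := rfl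

/-- [folklore] The recursion of `diag`. -/
@[simp] theorem diag_cons (p : 𝔸 × 𝔸) (l : List (𝔸 × 𝔸)) : diag (p :: l) = comm p.1 p.2 + diag l := by
  simp [diag]

/-- [folklore] `cross` is symmetric under swapping the two letters of every pair. -/
theorem cross_swap (l : List (𝔸 × 𝔸)) : cross (l.map Prod.swap) = cross l := by
  induction l with
  | nil => rfl
  | cons p l ih =>
    have hb : bg (l.map Prod.swap) = fl l := by simp [bg, fl]
    have hf : fl (l.map Prod.swap) = bg l := by simp [bg, fl]
    rw [List.map_cons, cross_cons, cross_cons, ih, hb, hf, Prod.fst_swap, Prod.snd_swap, add_comm (comm p.2 _)]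

/-- [folklore] Concatenation law of `cross`: the extra cross terms of the two blocks. -/
theorem cross_append (l₁ l₂ : List (𝔸 × 𝔸)) :
    cross (l₁ ++ l₂) = cross l₁ + cross l₂ + (comm (bg l₁).sum (fl l₂).sum + comm (fl l₁).sum (bg l₂).sum) := by
  induction l₁ with
  | nil => simp
  | cons p l ih =>
    simp only [List.cons_append, cross_cons, ih, bg_append, fl_append, List.sum_append, bg_cons, fl_cons,
      List.sum_cons, comm_add_left, comm_add_right]
    abel

/-- [folklore] `cross` vanishes when all first letters vanish. -/
theorem cross_eq_zero_of_fst (l : List (𝔸 × 𝔸)) (h : ∀ p ∈ l, p.1 = 0) : cross l = 0 := by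
  induction l with
  | nil => rfl
  | cons p l ih =>
    have hp : p.1 = 0 := h p (by simp)
    have hl : ∀ q ∈ l, q.1 = 0 := fun q hq => h q (by simp [hq])
    have hs : (bg l).sum = 0 := List.sum_eq_zero (by
      intro a ha; simp only [bg, List.mem_map] at ha; obtain ⟨q, hq, rfl⟩ := ha; exact hl q hq)
    rw [cross_cons, ih hl, hp, hs, comm_zero_left, comm_zero_right, add_zero, add_zero]

/-- [folklore] `cross` vanishes when all second letters vanish. -/
theorem cross_eq_zero_of_snd (l : List (𝔸 × 𝔸)) (h : ∀ p ∈ l, p.2 = 0) : cross l = 0 := by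
  have h' : ∀ p ∈ l.map Prod.swap, p.1 = 0 := by
    intro p hp; simp only [List.mem_map] at hp; obtain ⟨q, hq, rfl⟩ := hp; exact h q hq
  rw [← cross_swap, cross_eq_zero_of_fst _ h']

/-- [folklore] POLARISATION: the commutator sum of a sum of two letter strings read along the same positions. -/
theorem commSum_map_add {𝔸 : Type*} [NormedRing 𝔸] (l : List (𝔸 × 𝔸)) :
    commSum (l.map fun p => p.1 + p.2) = commSum (bg l) + commSum (fl l) + cross l := by
  induction l with
  | nil => simp
  | cons p l ih =>
    have hs : (l.map fun p : 𝔸 × 𝔸 => p.1 + p.2).sum = (bg l).sum + (fl l).sum := by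
      simp only [bg, fl, List.sum_map_add]
    simp only [List.map_cons, commSum_cons, ih, hs, bg_cons, fl_cons, cross_cons, comm]
    noncomm_ring

/-- [folklore] On the diagonal `cross (b,b) = 2·commSum`. -/
theorem cross_diag {𝔸 : Type*} [NormedRing 𝔸] (l : List 𝔸) :
    cross (l.map fun b => (b, b)) = (2 : ℤ) • commSum l := by
  induction l with
  | nil => simp
  | cons b l ih =>
    simp only [List.map_cons, cross_cons, ih, commSum_cons, bg_diag, fl_diag, comm]
    rw [two_zsmul, two_zsmul]; abel

end PairAlgebra

/-! ## §1b The integer wedge count -/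

section Wedge

variable {R : Type*} [CommRing R]

/-- [folklore] THE WEDGE COUNT of a list of integer pairs: `wedge l = Σ_{i<j} (a_i b_j − b_i a_j)`. -/
def wedge : List (R × R) → R
  | [] => 0
  | p :: l => wedge l + (p.1 * (fl l).sum - p.2 * (bg l).sum)

/-- [folklore] `wedge [] = 0`. -/
@[simp] theorem wedge_nil : wedge ([] : List (R × R)) = 0 := rfl

/-- [folklore] The recursion of `wedge`. -/
@[simp] theorem wedge_cons (p : R × R) (l : List (R × R)) :
    wedge (p :: l) = wedge l + (p.1 * (fl l).sum - p.2 * (bg l).sum) := rfl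

/-- [folklore] The wedge count is antisymmetric under swapping. -/
theorem wedge_swap (l : List (R × R)) : wedge (l.map Prod.swap) = -wedge l := by
  induction l with
  | nil => simp
  | cons p l ih =>
    have hb : bg (l.map Prod.swap) = fl l := by simp [bg, fl]
    have hf : fl (l.map Prod.swap) = bg l := by simp [bg, fl]
    rw [List.map_cons, wedge_cons, wedge_cons, ih, hb, hf, Prod.fst_swap, Prod.snd_swap]
    ring

/-- [folklore] `wedge` vanishes when all first letters vanish. -/
theorem wedge_eq_zero_of_fst (l : List (R × R)) (h : ∀ p ∈ l, p.1 = 0) : wedge l = 0 := by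
  induction l with
  | nil => rfl
  | cons p l ih =>
    have hp : p.1 = 0 := h p (by simp)
    have hl : ∀ q ∈ l, q.1 = 0 := fun q hq => h q (by simp [hq])
    have hs : (bg l).sum = 0 := List.sum_eq_zero (by
      intro a ha; simp only [bg, List.mem_map] at ha; obtain ⟨q, hq, rfl⟩ := ha; exact hl q hq)
    rw [wedge_cons, ih hl, hp, hs]; ring

/-- [folklore] `wedge` vanishes when all second letters vanish. -/
theorem wedge_eq_zero_of_snd (l : List (R × R)) (h : ∀ p ∈ l, p.2 = 0) : wedge l = 0 := by
  have h' : ∀ p ∈ l.map Prod.swap, p.1 = 0 := by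
    intro p hp; simp only [List.mem_map] at hp; obtain ⟨q, hq, rfl⟩ := hp; exact h q hq
  have := wedge_eq_zero_of_fst _ h'
  rw [wedge_swap, neg_eq_zero] at this
  exact this

/-- [folklore] A list of integers of absolute value `≤ 1` sums to at most its length in absolute value. -/
theorem abs_sum_le_length (l : List ℤ) (h : ∀ a ∈ l, |a| ≤ 1) : |l.sum| ≤ (l.length : ℤ) := by
  induction l with
  | nil => simp
  | cons a l ih =>
    have ha := h a (by simp)
    have hl : ∀ b ∈ l, |b| ≤ 1 := fun b hb => h b (by simp [hb])
    rw [List.sum_cons, List.length_cons]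
    push_cast
    have := abs_add_le a l.sum
    linarith [ih hl]

/-- [folklore] `|wedge l| ≤ |l|²` when every entry is bounded by one in absolute value. -/
theorem abs_wedge_le (l : List (ℤ × ℤ)) (h : ∀ p ∈ l, |p.1| ≤ 1 ∧ |p.2| ≤ 1) :
    |wedge l| ≤ (l.length : ℤ) ^ 2 := by
  induction l with
  | nil => simp
  | cons p l ih =>
    have hp := h p (by simp)
    have hl : ∀ q ∈ l, |q.1| ≤ 1 ∧ |q.2| ≤ 1 := fun q hq => h q (by simp [hq])
    have hb : |(bg l).sum| ≤ (l.length : ℤ) := by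
      rw [← bg_length l]
      refine abs_sum_le_length _ fun a ha => ?_
      simp only [bg, List.mem_map] at ha
      obtain ⟨q, hq, rfl⟩ := ha
      exact (hl q hq).1
    have hf : |(fl l).sum| ≤ (l.length : ℤ) := by
      rw [← fl_length l]
      refine abs_sum_le_length _ fun a ha => ?_
      simp only [fl, List.mem_map] at ha
      obtain ⟨q, hq, rfl⟩ := ha
      exact (hl q hq).2
    rw [wedge_cons, List.length_cons]
    have h1 : |p.1 * (fl l).sum| ≤ (l.length : ℤ) := by
      rw [abs_mul]; nlinarith [abs_nonneg p.1, abs_nonneg (fl l).sum, hp.1]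
    have h2 : |p.2 * (bg l).sum| ≤ (l.length : ℤ) := by
      rw [abs_mul]; nlinarith [abs_nonneg p.2, abs_nonneg (bg l).sum, hp.2]
    have h3 := abs_add_le (wedge l) (p.1 * (fl l).sum - p.2 * (bg l).sum)
    have h4 := abs_sub (p.1 * (fl l).sum) (p.2 * (bg l).sum)
    push_cast
    nlinarith [ih hl]

end Wedge

/-! ## §1c The identification `cross ∘ (n•w, n′•w′) = wedge • [w, w′]` -/

section Ident

variable {𝔸 : Type*} [Ring 𝔸]

/-- [folklore] The coefficient map `(n, n′) ↦ (n•w, n′•w′)`. -/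
def smulPair (w w' : 𝔸) : ℤ × ℤ →+ 𝔸 × 𝔸 :=
  AddMonoidHom.prodMap (zmultiplesHom 𝔸 w) (zmultiplesHom 𝔸 w')

/-- [folklore] `smulPair w w′ (n, m) = (n•w, m•w′)`. -/
@[simp] theorem smulPair_apply (w w' : 𝔸) (p : ℤ × ℤ) : smulPair w w' p = (p.1 • w, p.2 • w') := by
  rcases p with ⟨n, n'⟩; simp [smulPair]

/-- [folklore] First letters of a rescaled pair list sum to `(Σ first)•w`. -/
theorem sum_bg_map_smulPair (w w' : 𝔸) (l : List (ℤ × ℤ)) :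
    (bg (l.map (smulPair w w'))).sum = (bg l).sum • w := by
  induction l with
  | nil => simp
  | cons p l ih => simp [ih, add_smul]

/-- [folklore] Second letters of a rescaled pair list sum to `(Σ second)•w′`. -/
theorem sum_fl_map_smulPair (w w' : 𝔸) (l : List (ℤ × ℤ)) :
    (fl (l.map (smulPair w w'))).sum = (fl l).sum • w' := by
  induction l with
  | nil => simp
  | cons p l ih => simp [ih, add_smul]

/-- [folklore] **`cross` of a scaled integer pair list is the wedge count times the commutator.** -/
theorem cross_map_smulPair (w w' : 𝔸) (l : List (ℤ × ℤ)) :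
    cross (l.map (smulPair w w')) = wedge l • comm w w' := by
  induction l with
  | nil => simp
  | cons p l ih =>
    rw [List.map_cons, cross_cons, ih, sum_bg_map_smulPair, sum_fl_map_smulPair, smulPair_apply, wedge_cons]
    dsimp only
    rw [comm_zsmul_zsmul, comm_zsmul_zsmul, comm_anticomm w w', smul_neg, ← sub_eq_add_neg, ← sub_smul, ← add_smul]

/-- [folklore] `diag` of a scaled integer pair list. -/
theorem diag_map_smulPair (w w' : 𝔸) (l : List (ℤ × ℤ)) :
    diag (l.map (smulPair w w')) = (l.map fun p => p.1 * p.2).sum • comm w w' := by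
  induction l with
  | nil => simp
  | cons p l ih =>
    rw [List.map_cons, diag_cons, ih, smulPair_apply, List.map_cons, List.sum_cons, add_smul]
    dsimp only
    rw [comm_zsmul_zsmul]

end Ident


/-! ## §2 The letter-level functionals of the one-step average at `U = 1` (unnormalised, over any ring) -/

section Functionals

variable {d : ℕ} {𝔸 : Type*} [Ring 𝔸]

/-- [folklore] THE UNNORMALISED W-HESSIAN FUNCTIONAL of (any local logarithm of) the one-step average `Φ_b`,
`b = (μ, y)`, at `U = 1`: `hessU W W′ L μ y = 2L^d · H_b(W, W′)` with
`H_b(W,W′) = ½L^{−d} Σ_x crossComm(Γ_{c,x} ∪ (−c); W, W′) + ½L^{−d}([Z W, W′(c)] + [Z W′, W(c)]) + ½ crossComm(c; W, W′)`,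
`Z = linAvg` (node 5, (14) unnormalised), `W(c) = Σ` of the letters of `W` along the straight coarse bond `c`.
PURE LETTER ALGEBRA: nothing printed is asserted; the identification with the second jet of B7 (42) is node 7b. -/
def hessU (W W' : Form1 d 𝔸) (L : ℕ) (μ : Fin d) (y : Fin d → ℤ) : 𝔸 :=
  (∑ b ∈ box d L, cross (loopC (pairForm W W') L μ y b))
    + (comm (linAvg W L μ y) (segUp W' ((L : ℤ) • y) μ L).sum
        + comm (linAvg W' L μ y) (segUp W ((L : ℤ) • y) μ L).sum)
    + ((L : ℤ) ^ d) • cross (segUp (pairForm W W') ((L : ℤ) • y) μ L)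

/-- [folklore] The bondwise commutator one-form `x ↦ [W(x), B(x)]` (the same-bond BCH contact of the product chart). -/
def bw (W B : Form1 d 𝔸) : Form1 d 𝔸 := fun κ x => comm (W κ x) (B κ x)

/-- [folklore] `[W, B]_bw κ x = [W κ x, B κ x]`. -/
@[simp] theorem bw_apply (W B : Form1 d 𝔸) (κ : Fin d) (x : Fin d → ℤ) : bw W B κ x = comm (W κ x) (B κ x) := rfl

/-- [folklore] THE UNNORMALISED FIELD–MULTIPLIER ((V-H)) FUNCTIONAL in the PRODUCT chart `U = e^{W} e^{B}`:
`vhU W B L μ y = 2L^{2d} · M_b(W; B)`, `M_b(W;B) = H_b(W,B) + ½ Z([W,B]_bondwise) − ½ [Z W, Z B]` with `Z = L^{−d}·linAvg`. -/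
def vhU (W B : Form1 d 𝔸) (L : ℕ) (μ : Fin d) (y : Fin d → ℤ) : 𝔸 :=
  ((L : ℤ) ^ d) • hessU W B L μ y + ((L : ℤ) ^ d) • linAvg (bw W B) L μ y
    - comm (linAvg W L μ y) (linAvg B L μ y)

/-- [folklore] Swapping the two forms of a pair form is the push-forward along `Prod.swap`. -/
theorem pairForm_swap (W W' : Form1 d 𝔸) :
    pairForm W' W = mapForm (AddEquiv.prodComm : 𝔸 × 𝔸 ≃+ 𝔸 × 𝔸).toAddMonoidHom (pairForm W W') := by
  funext κ x; rfl

/-- [folklore] Swapping the pair form swaps the letters of the loop lists. -/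
theorem loopC_pairForm_swap (W W' : Form1 d 𝔸) (L : ℕ) (μ : Fin d) (y : Fin d → ℤ) (b : Fin d → ℕ) :
    loopC (pairForm W' W) L μ y b = (loopC (pairForm W W') L μ y b).map Prod.swap := by
  rw [pairForm_swap, ← loopC_map]; rfl

/-- [folklore] Swapping the pair form swaps the letters of a segment list. -/
theorem segUp_pairForm_swap (W W' : Form1 d 𝔸) (z : Fin d → ℤ) (κ : Fin d) (n : ℕ) :
    segUp (pairForm W' W) z κ n = (segUp (pairForm W W') z κ n).map Prod.swap := by
  rw [pairForm_swap, ← segUp_map]; rfl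

/-- [folklore] **The W-Hessian functional is symmetric** (as it must be: it is a polarisation). -/
theorem hessU_symm (W W' : Form1 d 𝔸) (L : ℕ) (μ : Fin d) (y : Fin d → ℤ) :
    hessU W' W L μ y = hessU W W' L μ y := by
  simp only [hessU, loopC_pairForm_swap W W', segUp_pairForm_swap W W', cross_swap]
  abel

end Functionals

/-! ## §3 The integer count kernels `q¹`, `h`, `m` and the single-bond identification theorems -/

section Counts

variable {d : ℕ}

/-- [folklore] A fine BOND `(κ, x)` = the lattice bond `[x, x + e_κ]` (node 5's letter `A κ x`). -/
abbrev Bond (d : ℕ) : Type := Fin d × (Fin d → ℤ)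

/-- [folklore] The one-form supported on the single bond `f` with value `w`. -/
def single {𝔸 : Type*} [Zero 𝔸] (f : Bond d) (w : 𝔸) : Form1 d 𝔸 := fun κ x => if (κ, x) = f then w else 0

/-- [folklore] Evaluation of `single`. -/
@[simp] theorem single_apply {𝔸 : Type*} [Zero 𝔸] (f : Bond d) (w : 𝔸) (κ : Fin d) (x : Fin d → ℤ) :
    single f w κ x = if (κ, x) = f then w else 0 := rfl

/-- [folklore] The INDICATOR one-form `δ_f` of the bond `f`. -/
def δ1 (f : Bond d) : Form1 d ℤ := single f 1

/-- [folklore] Evaluation of `δ1`. -/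
@[simp] theorem δ1_apply (f : Bond d) (κ : Fin d) (x : Fin d → ℤ) : δ1 f κ x = if (κ, x) = f then 1 else 0 := rfl

variable {𝔸 : Type*} [Ring 𝔸]

/-- [folklore] `single f w` is the image of `δ1 f` under `n ↦ n•w`. -/
theorem single_eq_mapForm (f : Bond d) (w : 𝔸) : single f w = mapForm (zmultiplesHom 𝔸 w) (δ1 f) := by
  funext κ x
  simp only [single_apply, mapForm_apply, δ1_apply, zmultiplesHom_apply]
  split_ifs <;> simp

/-- [folklore] The pair form of two single-bond forms is the rescaled pair form of the indicators. -/
theorem pairForm_single (f f' : Bond d) (w w' : 𝔸) :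
    pairForm (single f w) (single f' w') = mapForm (smulPair w w') (pairForm (δ1 f) (δ1 f')) := by
  funext κ x
  simp only [pairForm_apply, single_apply, mapForm_apply, δ1_apply, smulPair_apply]
  split_ifs <;> simp

/-- [folklore] `q¹` UNNORMALISED: the integer first-jet kernel `linCount L μ y f = (linAvg δ_f)` = the signed number of
passages of the contours `Γ_{c,x}`, `x ∈ B(c₋)`, through the bond `f` (`= L^d · q¹_b(f)`). -/
def linCount (L : ℕ) (μ : Fin d) (y : Fin d → ℤ) (f : Bond d) : ℤ := linAvg (δ1 f) L μ y

/-- [folklore] The signed multiplicity of the bond `f` on the straight coarse bond `c` (`∈ {0, 1}`). -/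
def cCount (L : ℕ) (μ : Fin d) (y : Fin d → ℤ) (f : Bond d) : ℤ := (segUp (δ1 f) ((L : ℤ) • y) μ L).sum

/-- [folklore] `h` UNNORMALISED: the integer W-Hessian kernel (`= 2L^d · h_b(f, f′)`). -/
def hessCount (L : ℕ) (μ : Fin d) (y : Fin d → ℤ) (f f' : Bond d) : ℤ :=
  (∑ b ∈ box d L, wedge (loopC (pairForm (δ1 f) (δ1 f')) L μ y b))
    + (linCount L μ y f * cCount L μ y f' - linCount L μ y f' * cCount L μ y f)
    + (L : ℤ) ^ d * wedge (segUp (pairForm (δ1 f) (δ1 f')) ((L : ℤ) • y) μ L)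

/-- [folklore] `m` UNNORMALISED: the integer field–multiplier kernel in the product chart (`= 2L^{2d} · m_b(f, f′)`):
`vhCount = L^d · hessCount + L^d · [f = f′] · linCount f − linCount f · linCount f′`. -/
def vhCount (L : ℕ) (μ : Fin d) (y : Fin d → ℤ) (f f' : Bond d) : ℤ :=
  (L : ℤ) ^ d * hessCount L μ y f f' + (L : ℤ) ^ d * (if f = f' then linCount L μ y f else 0)
    - linCount L μ y f * linCount L μ y f'

/-- [folklore] Naturality of node 5's `linAvg` in the coefficients. -/
theorem linAvg_mapForm {R R' : Type*} [AddCommGroup R] [AddCommGroup R'] (φ : R →+ R') (A : Form1 d R) (L : ℕ)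
    (μ : Fin d) (y : Fin d → ℤ) : linAvg (mapForm φ A) L μ y = φ (linAvg A L μ y) := by
  simp only [linAvg, ← gammaC_map, map_sum, map_list_sum]

/-- [folklore] `linAvg (single f w) = linCount f • w`. -/
theorem linAvg_single (f : Bond d) (w : 𝔸) (L : ℕ) (μ : Fin d) (y : Fin d → ℤ) :
    linAvg (single f w) L μ y = linCount L μ y f • w := by
  rw [single_eq_mapForm, linAvg_mapForm, zmultiplesHom_apply, linCount]

/-- [folklore] The coarse-bond segment sum of `single f w` is `cCount f • w`. -/
theorem segUp_sum_single (f : Bond d) (w : 𝔸) (L : ℕ) (μ : Fin d) (y : Fin d → ℤ) :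
    (segUp (single f w) ((L : ℤ) • y) μ L).sum = cCount L μ y f • w := by
  rw [single_eq_mapForm, ← segUp_map, ← map_list_sum, zmultiplesHom_apply, cCount]

/-- [folklore] **IDENTIFICATION (W-Hessian).** On single-bond forms the functional `hessU` is the integer kernel times the
commutator of the two values: `hessU (w·δ_f) (w′·δ_{f′}) = hessCount f f′ • [w, w′]`. -/
theorem hessU_single (f f' : Bond d) (w w' : 𝔸) (L : ℕ) (μ : Fin d) (y : Fin d → ℤ) :
    hessU (single f w) (single f' w') L μ y = hessCount L μ y f f' • comm w w' := by
  have h1 : ∀ b, cross (loopC (pairForm (single f w) (single f' w')) L μ y b)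
      = wedge (loopC (pairForm (δ1 f) (δ1 f')) L μ y b) • comm w w' := by
    intro b
    rw [pairForm_single, ← loopC_map, cross_map_smulPair]
  have h2 : cross (segUp (pairForm (single f w) (single f' w')) ((L : ℤ) • y) μ L)
      = wedge (segUp (pairForm (δ1 f) (δ1 f')) ((L : ℤ) • y) μ L) • comm w w' := by
    rw [pairForm_single, ← segUp_map, cross_map_smulPair]
  simp only [hessU, h1, h2, linAvg_single, segUp_sum_single, comm_zsmul_zsmul, hessCount, ← Finset.sum_smul,
    smul_smul, comm_anticomm w w', smul_neg, add_smul, sub_smul]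
  abel

/-- [folklore] The bondwise commutator of two single-bond forms. -/
theorem bw_single (f f' : Bond d) (w v : 𝔸) :
    bw (single f w) (single f' v) = single f (if f = f' then comm w v else 0) := by
  funext κ x
  simp only [bw_apply, single_apply]
  by_cases h : (κ, x) = f
  · by_cases h' : (κ, x) = f'
    · have : f = f' := h.symm.trans h'
      simp [h, this]
    · have : f ≠ f' := fun e => h' (h.trans e)
      simp [h, this]
  · simp [h]

/-- [folklore] **IDENTIFICATION (field–multiplier block).** `vhU (w·δ_f) (v·δ_{f′}) = vhCount f f′ • [w, v]`. -/
theorem vhU_single (f f' : Bond d) (w v : 𝔸) (L : ℕ) (μ : Fin d) (y : Fin d → ℤ) :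
    vhU (single f w) (single f' v) L μ y = vhCount L μ y f f' • comm w v := by
  rw [vhU, hessU_single, bw_single, linAvg_single, linAvg_single, linAvg_single, comm_zsmul_zsmul, vhCount,
    smul_smul, sub_smul, add_smul, mul_smul ((L : ℤ) ^ d) (ite _ _ _)]
  congr 2
  split_ifs <;> simp

/-- [folklore] `hessCount` is ANTISYMMETRIC. -/
theorem hessCount_swap (L : ℕ) (μ : Fin d) (y : Fin d → ℤ) (f f' : Bond d) :
    hessCount L μ y f' f = -hessCount L μ y f f' := by
  have h1 : ∀ b, wedge (loopC (pairForm (δ1 f') (δ1 f)) L μ y b) = -wedge (loopC (pairForm (δ1 f) (δ1 f')) L μ y b) := by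
    intro b; rw [loopC_pairForm_swap (δ1 f) (δ1 f'), wedge_swap]
  have h2 : wedge (segUp (pairForm (δ1 f') (δ1 f)) ((L : ℤ) • y) μ L)
      = -wedge (segUp (pairForm (δ1 f) (δ1 f')) ((L : ℤ) • y) μ L) := by
    rw [segUp_pairForm_swap (δ1 f) (δ1 f'), wedge_swap]
  simp only [hessCount, h1, h2, Finset.sum_neg_distrib]
  ring

/-- [folklore] `hessCount f f = 0`. -/
@[simp] theorem hessCount_self (L : ℕ) (μ : Fin d) (y : Fin d → ℤ) (f : Bond d) : hessCount L μ y f f = 0 := by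
  have := hessCount_swap L μ y f f
  omega

end Counts

/-! ## §4 Support: where the letters of the contours live -/

section Support

variable {d : ℕ} {R : Type*} [AddCommGroup R]

/-- [folklore] Every letter of `l` is `± A κ x` for some bond `(κ, x)` whose base point satisfies `P`. -/
def LettersIn (A : Form1 d R) (P : (Fin d → ℤ) → Prop) (l : List R) : Prop :=
  ∀ a ∈ l, ∃ κ x, P x ∧ (a = A κ x ∨ a = -A κ x)

/-- [folklore] Monotonicity of `LettersIn` in the region. -/
theorem LettersIn.mono {A : Form1 d R} {P Q : (Fin d → ℤ) → Prop} (hPQ : ∀ x, P x → Q x) {l : List R}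
    (h : LettersIn A P l) : LettersIn A Q l := fun a ha => by
  obtain ⟨κ, x, hx, h⟩ := h a ha
  exact ⟨κ, x, hPQ x hx, h⟩

/-- [folklore] `LettersIn` is stable under concatenation. -/
theorem LettersIn.append {A : Form1 d R} {P : (Fin d → ℤ) → Prop} {l₁ l₂ : List R} (h₁ : LettersIn A P l₁)
    (h₂ : LettersIn A P l₂) : LettersIn A P (l₁ ++ l₂) := fun a ha => by
  rcases List.mem_append.1 ha with h | h
  exacts [h₁ a h, h₂ a h]

/-- [folklore] `LettersIn` is stable under node 5's `rev` (letters negated and reversed). -/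
theorem LettersIn.rev {A : Form1 d R} {P : (Fin d → ℤ) → Prop} {l : List R} (h : LettersIn A P l) :
    LettersIn A P (rev l) := by
  intro a ha
  unfold AveragingContours.rev at ha
  rw [List.mem_reverse] at ha
  obtain ⟨b, hb, rfl⟩ := List.mem_map.1 ha
  obtain ⟨κ, x, hx, h⟩ := h b hb
  refine ⟨κ, x, hx, ?_⟩
  rcases h with h | h
  · right; rw [h]
  · left; rw [h, neg_neg]

omit [AddCommGroup R] in
/-- [folklore] Membership in `segUp`: the letters are the values `A κ (z + s e_κ)`, `s < n`. -/
theorem mem_segUp {A : Form1 d R} {z : Fin d → ℤ} {κ : Fin d} {n : ℕ} {a : R} (ha : a ∈ segUp A z κ n) :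
    ∃ s : ℕ, s < n ∧ a = A κ (z + (s : ℤ) • unitVec κ) := by
  induction n with
  | zero => simp at ha
  | succ n ih =>
    rw [segUp_succ, List.mem_append, List.mem_singleton] at ha
    rcases ha with ha | ha
    · obtain ⟨s, hs, h⟩ := ih ha
      exact ⟨s, by omega, h⟩
    · exact ⟨n, by omega, ha⟩

/-- [folklore] Membership in `segDown`: the letters are `−A κ (z − (s+1) e_κ)`, `s < n`. -/
theorem mem_segDown {A : Form1 d R} {z : Fin d → ℤ} {κ : Fin d} {n : ℕ} {a : R} (ha : a ∈ segDown A z κ n) :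
    ∃ s : ℕ, s < n ∧ a = -A κ (z - ((s : ℤ) + 1) • unitVec κ) := by
  induction n with
  | zero => simp at ha
  | succ n ih =>
    rw [segDown_succ, List.mem_append, List.mem_singleton] at ha
    rcases ha with ha | ha
    · obtain ⟨s, hs, h⟩ := ih ha
      exact ⟨s, by omega, h⟩
    · exact ⟨n, by omega, ha⟩

/-- [folklore] The empty list has its letters anywhere. -/
theorem lettersIn_nil (A : Form1 d R) (P : (Fin d → ℤ) → Prop) : LettersIn A P [] := fun a ha => by simp at ha

/-- [folklore] The coordinatewise hull of two lattice points. -/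
def Hull (y x : Fin d → ℤ) (x' : Fin d → ℤ) : Prop := ∀ i, min (y i) (x i) ≤ x' i ∧ x' i ≤ max (y i) (x i)

/-- [folklore] The letters of a signed segment live in its hull. -/
theorem lettersIn_seg (A : Form1 d R) (z : Fin d → ℤ) (κ : Fin d) (n : ℤ) :
    LettersIn A (Hull z (z + n • unitVec κ)) (seg A z κ n) := by
  intro a ha
  unfold seg at ha
  split_ifs at ha with hn
  · obtain ⟨s, hs', rfl⟩ := mem_segUp ha
    refine ⟨κ, _, fun i => ?_, Or.inl rfl⟩
    simp only [Pi.add_apply, Pi.smul_apply, unitVec_apply, smul_eq_mul]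
    refine ⟨min_le_iff.2 ?_, le_max_iff.2 ?_⟩ <;> split_ifs <;> omega
  · obtain ⟨s, hs', rfl⟩ := mem_segDown ha
    refine ⟨κ, _, fun i => ?_, Or.inr rfl⟩
    simp only [Pi.add_apply, Pi.sub_apply, Pi.smul_apply, unitVec_apply, smul_eq_mul]
    refine ⟨min_le_iff.2 ?_, le_max_iff.2 ?_⟩ <;> split_ifs <;> omega

omit [AddCommGroup R] in
/-- [folklore] A corner coordinate is one of the two endpoint coordinates. -/
theorem corner_apply_or (y x : Fin d → ℤ) (m : ℕ) (i : Fin d) : corner y x m i = y i ∨ corner y x m i = x i := by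
  unfold corner; split_ifs <;> simp

/-- [folklore] The letters of the axial contour pieces live in the hull of the endpoints. -/
theorem lettersIn_axialAux (A : Form1 d R) (y x : Fin d → ℤ) : ∀ m, LettersIn A (Hull y x) (axialAux A y x m)
  | 0 => lettersIn_nil A _
  | m + 1 => by
    refine LettersIn.append ?_ (lettersIn_axialAux A y x m)
    split_ifs with h
    · have hs := lettersIn_seg A (corner y x (m + 1)) ⟨m, h⟩ (x ⟨m, h⟩ - y ⟨m, h⟩)
      rw [corner_succ_add] at hs
      refine hs.mono fun x' hx' i => ?_
      have h1 := hx' i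
      rcases corner_apply_or y x (m + 1) i with e1 | e1 <;> rcases corner_apply_or y x m i with e2 | e2 <;>
        · rw [e1, e2] at h1
          refine ⟨min_le_iff.2 ?_, le_max_iff.2 ?_⟩ <;>
            rcases h1 with ⟨h1a, h1b⟩ <;> rw [min_le_iff] at h1a <;> rw [le_max_iff] at h1b <;> omega
    · exact lettersIn_nil A _

/-- [folklore] The letters of the axial contour `Γ_{y,x}` are bonds based in the coordinate hull of `y` and `x`. -/
theorem lettersIn_axial (A : Form1 d R) (y x : Fin d → ℤ) : LettersIn A (Hull y x) (axial A y x) :=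
  lettersIn_axialAux A y x d

/-- [folklore] THE SUPPORT BOX of the coarse bond `(μ, y)`: base points `x′` with `L·y_i ≤ x′_i ≤ L·y_i + 2L − 1`. -/
def Near (L : ℕ) (y x' : Fin d → ℤ) : Prop := ∀ i, (L : ℤ) * y i ≤ x' i ∧ x' i ≤ (L : ℤ) * y i + (2 * L - 1)

/-- [folklore] Every letter of `Γ_{c,x}`, `x ∈ B(c₋)`, is a bond based in the support box. -/
theorem lettersIn_gammaC (A : Form1 d R) (L : ℕ) (μ : Fin d) (y : Fin d → ℤ) {b : Fin d → ℕ} (hb : b ∈ box d L) :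
    LettersIn A (Near L y) (gammaC A L μ y b) := by
  have hb' : ∀ i, b i < L := by simpa [AffineAveraging.box, Fintype.mem_piFinset, Finset.mem_range] using hb
  refine LettersIn.append (LettersIn.append ?_ ?_) ?_
  · refine (lettersIn_axial A _ _).mono fun x' hx' i => ?_
    obtain ⟨h1, h2⟩ := hx' i
    have hi := hb' i
    simp only [Pi.add_apply, Pi.smul_apply, smul_eq_mul, toSite] at h1 h2
    rw [min_le_iff] at h1; rw [le_max_iff] at h2
    constructor <;> omega
  · intro a ha
    obtain ⟨s, hs', rfl⟩ := mem_segUp ha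
    refine ⟨μ, _, fun i => ?_, Or.inl rfl⟩
    have hi := hb' i
    simp only [Pi.add_apply, Pi.smul_apply, smul_eq_mul, toSite, unitVec_apply]
    split_ifs <;> constructor <;> omega
  · refine (lettersIn_axial A _ _).rev.mono fun x' hx' i => ?_
    obtain ⟨h1, h2⟩ := hx' i
    have hi := hb' i
    simp only [Pi.add_apply, Pi.smul_apply, smul_eq_mul, toSite, unitVec_apply] at h1 h2
    rw [min_le_iff] at h1; rw [le_max_iff] at h2
    split_ifs at h1 h2 <;> constructor <;> omega

/-- [folklore] Every letter of the straight coarse bond `c` is based in the support box. -/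
theorem lettersIn_cSeg (A : Form1 d R) (L : ℕ) (μ : Fin d) (y : Fin d → ℤ) :
    LettersIn A (Near L y) (segUp A ((L : ℤ) • y) μ L) := by
  intro a ha
  obtain ⟨s, hs', rfl⟩ := mem_segUp ha
  refine ⟨μ, _, fun i => ?_, Or.inl rfl⟩
  simp only [Pi.add_apply, Pi.smul_apply, smul_eq_mul, unitVec_apply]
  split_ifs <;> constructor <;> omega

/-- [folklore] Every letter of the closed loop `Γ_{c,x} ∪ (−c)` is based in the support box. -/
theorem lettersIn_loopC (A : Form1 d R) (L : ℕ) (μ : Fin d) (y : Fin d → ℤ) {b : Fin d → ℕ} (hb : b ∈ box d L) :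
    LettersIn A (Near L y) (loopC A L μ y b) :=
  (lettersIn_gammaC A L μ y hb).append (lettersIn_cSeg A L μ y).rev

/-! ### Consequences for indicator forms -/

/-- [folklore] An indicator form supported outside the region has letter sum `0` on a list living in the region. -/
theorem sum_eq_zero_of_lettersIn {P : (Fin d → ℤ) → Prop} {f : Bond d} (hf : ¬ P f.2) {l : List ℤ}
    (h : LettersIn (δ1 f) P l) : l.sum = 0 := by
  refine List.sum_eq_zero fun a ha => ?_
  obtain ⟨κ, x, hx, ha⟩ := h a ha
  have h0 : δ1 f κ x = 0 := by
    rw [δ1_apply, if_neg]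
    rintro rfl
    exact hf hx
  rcases ha with ha | ha
  · rw [ha, h0]
  · rw [ha, h0, neg_zero]

/-- [folklore] Letters of an indicator form are bounded by `1`. -/
theorem abs_le_one_of_lettersIn {P : (Fin d → ℤ) → Prop} {f : Bond d} {l : List ℤ} (h : LettersIn (δ1 f) P l) :
    ∀ a ∈ l, |a| ≤ 1 := by
  intro a ha
  obtain ⟨κ, x, -, ha⟩ := h a ha
  rcases ha with ha | ha <;> · rw [ha]; simp only [δ1_apply, abs_neg]; split_ifs <;> simp

/-- [folklore] First letters of a pair-indicator list vanish off the support of the first bond. -/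
theorem fst_eq_zero_of_lettersIn {P : (Fin d → ℤ) → Prop} {f f' : Bond d} (hf : ¬ P f.2) {l : List (ℤ × ℤ)}
    (h : LettersIn (pairForm (δ1 f) (δ1 f')) P l) : ∀ p ∈ l, p.1 = 0 := by
  intro p hp
  obtain ⟨κ, x, hx, hp⟩ := h p hp
  have h0 : δ1 f κ x = 0 := by
    rw [δ1_apply, if_neg]
    rintro rfl
    exact hf hx
  rcases hp with hp | hp
  · rw [hp, pairForm_apply, h0]
  · rw [hp, pairForm_apply, h0, Prod.neg_mk, neg_zero]

/-- [folklore] Second letters of a pair-indicator list vanish off the support of the second bond. -/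
theorem snd_eq_zero_of_lettersIn {P : (Fin d → ℤ) → Prop} {f f' : Bond d} (hf' : ¬ P f'.2) {l : List (ℤ × ℤ)}
    (h : LettersIn (pairForm (δ1 f) (δ1 f')) P l) : ∀ p ∈ l, p.2 = 0 := by
  intro p hp
  obtain ⟨κ, x, hx, hp⟩ := h p hp
  have h0 : δ1 f' κ x = 0 := by
    rw [δ1_apply, if_neg]
    rintro rfl
    exact hf' hx
  rcases hp with hp | hp
  · rw [hp, pairForm_apply, h0]
  · rw [hp, pairForm_apply, h0, Prod.neg_mk, neg_zero]

/-- [folklore] Both letters of a pair-indicator list are bounded by `1`. -/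
theorem abs_le_one_of_lettersIn_pair {P : (Fin d → ℤ) → Prop} {f f' : Bond d} {l : List (ℤ × ℤ)}
    (h : LettersIn (pairForm (δ1 f) (δ1 f')) P l) : ∀ p ∈ l, |p.1| ≤ 1 ∧ |p.2| ≤ 1 := by
  intro p hp
  obtain ⟨κ, x, -, hp⟩ := h p hp
  rcases hp with hp | hp <;>
    · rw [hp]; simp only [pairForm_apply, δ1_apply, Prod.neg_mk, abs_neg]
      constructor <;> split_ifs <;> simp

/-! ### FINITE RANGE of the three kernels -/

/-- [folklore] `q¹` vanishes off the support box. -/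
theorem linCount_eq_zero {L : ℕ} {μ : Fin d} {y : Fin d → ℤ} {f : Bond d} (h : ¬ Near L y f.2) :
    linCount L μ y f = 0 :=
  Finset.sum_eq_zero fun _ hb => sum_eq_zero_of_lettersIn h (lettersIn_gammaC _ L μ y hb)

/-- [folklore] `cCount` vanishes off the support box. -/
theorem cCount_eq_zero {L : ℕ} {μ : Fin d} {y : Fin d → ℤ} {f : Bond d} (h : ¬ Near L y f.2) : cCount L μ y f = 0 :=
  sum_eq_zero_of_lettersIn h (lettersIn_cSeg _ L μ y)

/-- [folklore] `h` vanishes unless BOTH bonds lie in the support box. -/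
theorem hessCount_eq_zero_left {L : ℕ} {μ : Fin d} {y : Fin d → ℤ} {f : Bond d} (h : ¬ Near L y f.2) (f' : Bond d) :
    hessCount L μ y f f' = 0 := by
  have h1 : ∀ b ∈ box d L, wedge (loopC (pairForm (δ1 f) (δ1 f')) L μ y b) = 0 := fun b hb =>
    wedge_eq_zero_of_fst _ (fst_eq_zero_of_lettersIn h (lettersIn_loopC _ L μ y hb))
  have h2 : wedge (segUp (pairForm (δ1 f) (δ1 f')) ((L : ℤ) • y) μ L) = 0 :=
    wedge_eq_zero_of_fst _ (fst_eq_zero_of_lettersIn h (lettersIn_cSeg _ L μ y))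
  rw [hessCount, Finset.sum_eq_zero h1, h2, linCount_eq_zero h, cCount_eq_zero h]
  ring

/-- [folklore] `hessCount` vanishes when the second bond is off the support box. -/
theorem hessCount_eq_zero_right {L : ℕ} {μ : Fin d} {y : Fin d → ℤ} (f : Bond d) {f' : Bond d} (h : ¬ Near L y f'.2) :
    hessCount L μ y f f' = 0 := by
  rw [← neg_neg (hessCount L μ y f f'), ← hessCount_swap, hessCount_eq_zero_left h, neg_zero]

/-- [folklore] `m` vanishes unless BOTH bonds lie in the support box. -/
theorem vhCount_eq_zero_left {L : ℕ} {μ : Fin d} {y : Fin d → ℤ} {f : Bond d} (h : ¬ Near L y f.2) (f' : Bond d) :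
    vhCount L μ y f f' = 0 := by
  rw [vhCount, hessCount_eq_zero_left h, linCount_eq_zero h]
  split_ifs <;> simp

/-- [folklore] `vhCount` vanishes when the second bond is off the support box. -/
theorem vhCount_eq_zero_right {L : ℕ} {μ : Fin d} {y : Fin d → ℤ} (f : Bond d) {f' : Bond d} (h : ¬ Near L y f'.2) :
    vhCount L μ y f f' = 0 := by
  rw [vhCount, hessCount_eq_zero_right f h, linCount_eq_zero h]
  split_ifs with e
  · subst e; rw [linCount_eq_zero h]; simp
  · simp

end Support

/-! ## §5 Entry bounds (crude, polynomial in `L` and `d`) -/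

section Bounds

variable {d : ℕ}

/-- [folklore] A common bound `ℓ = (2d+2)L` for the lengths of `Γ_{c,x}`, `Γ_{c,x} ∪ (−c)` and `c`. -/
def ell (d L : ℕ) : ℕ := (2 * d + 2) * L

/-- [folklore] `|Γ_{b,x}| ≤ ℓ`. -/
theorem gammaC_length_le_ell {R : Type*} [AddCommGroup R] (A : Form1 d R) {L : ℕ} (hL : 1 ≤ L) (μ : Fin d)
    (y : Fin d → ℤ) {b : Fin d → ℕ} (hb : b ∈ box d L) : (gammaC A L μ y b).length ≤ ell d L := by
  have := gammaC_length_le A hL μ y hb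
  unfold ell; have : (2 * d + 1) * L - 2 * d ≤ (2 * d + 2) * L := by
    have := Nat.sub_le ((2 * d + 1) * L) (2 * d); nlinarith
  omega

/-- [folklore] `|Γ_{b,x} ∪ (−c)| ≤ ℓ`. -/
theorem loopC_length_le_ell {R : Type*} [AddCommGroup R] (A : Form1 d R) {L : ℕ} (hL : 1 ≤ L) (μ : Fin d)
    (y : Fin d → ℤ) {b : Fin d → ℕ} (hb : b ∈ box d L) : (loopC A L μ y b).length ≤ ell d L := by
  have := loopC_length_le A hL μ y hb
  unfold ell; have : (2 * d + 2) * L - 2 * d ≤ (2 * d + 2) * L := Nat.sub_le _ _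
  omega

/-- [folklore] `L ≤ ℓ`. -/
theorem le_ell {L : ℕ} : L ≤ ell d L := by unfold ell; nlinarith

/-- [folklore] `|q¹| ≤ L^d · ℓ` (unnormalised). -/
theorem abs_linCount_le {L : ℕ} (hL : 1 ≤ L) (μ : Fin d) (y : Fin d → ℤ) (f : Bond d) :
    |linCount L μ y f| ≤ (L : ℤ) ^ d * ell d L := by
  unfold linCount linAvg
  refine (Finset.abs_sum_le_sum_abs _ _).trans ?_
  have h : ∀ b ∈ box d L, |(gammaC (δ1 f) L μ y b).sum| ≤ (ell d L : ℤ) := fun b hb =>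
    (abs_sum_le_length _ (abs_le_one_of_lettersIn (lettersIn_gammaC _ L μ y hb))).trans
      (by exact_mod_cast gammaC_length_le_ell _ hL μ y hb)
  refine (Finset.sum_le_card_nsmul _ _ _ h).trans ?_
  -- `#box = L^d` is `Literature.Algebra.EuclideanLattices.Regev2004.card_box`; kept local (as in an2's `AffineAveraging`)
  have hcard : (box d L).card = L ^ d := by simp [AffineAveraging.box, Fintype.card_piFinset]
  rw [hcard, nsmul_eq_mul]; push_cast; exact le_rfl

/-- [folklore] `|cCount| ≤ L`. -/
theorem abs_cCount_le (L : ℕ) (μ : Fin d) (y : Fin d → ℤ) (f : Bond d) : |cCount L μ y f| ≤ L := by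
  unfold cCount
  refine (abs_sum_le_length _ (abs_le_one_of_lettersIn (lettersIn_cSeg _ L μ y))).trans ?_
  rw [segUp_length]

/-- [folklore] `|h| ≤ 4 L^d ℓ²` (unnormalised). -/
theorem abs_hessCount_le {L : ℕ} (hL : 1 ≤ L) (μ : Fin d) (y : Fin d → ℤ) (f f' : Bond d) :
    |hessCount L μ y f f'| ≤ 4 * (L : ℤ) ^ d * (ell d L : ℤ) ^ 2 := by
  have hLd : (1 : ℤ) ≤ (L : ℤ) ^ d := by exact_mod_cast Nat.one_le_pow _ _ hL
  have hℓ : (L : ℤ) ≤ ell d L := by exact_mod_cast le_ell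
  have hℓ0 : (0 : ℤ) ≤ L := by positivity
  have h1 : |∑ b ∈ box d L, wedge (loopC (pairForm (δ1 f) (δ1 f')) L μ y b)| ≤ (L : ℤ) ^ d * (ell d L : ℤ) ^ 2 := by
    refine (Finset.abs_sum_le_sum_abs _ _).trans ?_
    have h : ∀ b ∈ box d L, |wedge (loopC (pairForm (δ1 f) (δ1 f')) L μ y b)| ≤ (ell d L : ℤ) ^ 2 := fun b hb =>
      (abs_wedge_le _ (abs_le_one_of_lettersIn_pair (lettersIn_loopC _ L μ y hb))).trans
        (pow_le_pow_left₀ (by positivity) (by exact_mod_cast loopC_length_le_ell _ hL μ y hb) 2)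
    refine (Finset.sum_le_card_nsmul _ _ _ h).trans ?_
    have hcard : (box d L).card = L ^ d := by simp [AffineAveraging.box, Fintype.card_piFinset]
    rw [hcard, nsmul_eq_mul]; push_cast; exact le_rfl
  have h2 : |linCount L μ y f * cCount L μ y f' - linCount L μ y f' * cCount L μ y f|
      ≤ 2 * ((L : ℤ) ^ d * (ell d L : ℤ) ^ 2) := by
    have ha := abs_linCount_le hL μ y f
    have hb := abs_linCount_le hL μ y f'
    have hc := abs_cCount_le L μ y f
    have hd := abs_cCount_le L μ y f'
    have := abs_sub (linCount L μ y f * cCount L μ y f') (linCount L μ y f' * cCount L μ y f)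
    rw [abs_mul, abs_mul] at this
    have e1 : |linCount L μ y f| * |cCount L μ y f'| ≤ ((L : ℤ) ^ d * ell d L) * ell d L :=
      mul_le_mul ha (hd.trans hℓ) (abs_nonneg _) (by positivity)
    have e2 : |linCount L μ y f'| * |cCount L μ y f| ≤ ((L : ℤ) ^ d * ell d L) * ell d L :=
      mul_le_mul hb (hc.trans hℓ) (abs_nonneg _) (by positivity)
    nlinarith
  have h3 : |(L : ℤ) ^ d * wedge (segUp (pairForm (δ1 f) (δ1 f')) ((L : ℤ) • y) μ L)| ≤ (L : ℤ) ^ d * (ell d L : ℤ) ^ 2 := by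
    rw [abs_mul, abs_of_nonneg (by positivity : (0 : ℤ) ≤ (L : ℤ) ^ d)]
    refine mul_le_mul_of_nonneg_left ?_ (by positivity)
    refine (abs_wedge_le _ (abs_le_one_of_lettersIn_pair (lettersIn_cSeg _ L μ y))).trans ?_
    rw [segUp_length]
    exact pow_le_pow_left₀ hℓ0 hℓ 2
  rw [hessCount]
  have := abs_add_three (∑ b ∈ box d L, wedge (loopC (pairForm (δ1 f) (δ1 f')) L μ y b))
    (linCount L μ y f * cCount L μ y f' - linCount L μ y f' * cCount L μ y f)
    ((L : ℤ) ^ d * wedge (segUp (pairForm (δ1 f) (δ1 f')) ((L : ℤ) • y) μ L))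
  linarith

/-- [folklore] `|m| ≤ 6 L^{2d} ℓ²` (unnormalised). -/
theorem abs_vhCount_le {L : ℕ} (hL : 1 ≤ L) (μ : Fin d) (y : Fin d → ℤ) (f f' : Bond d) :
    |vhCount L μ y f f'| ≤ 6 * (L : ℤ) ^ (2 * d) * (ell d L : ℤ) ^ 2 := by
  have hLd : (1 : ℤ) ≤ (L : ℤ) ^ d := by exact_mod_cast Nat.one_le_pow _ _ hL
  have hℓ1 : (1 : ℤ) ≤ ell d L := by have := @le_ell d L; omega
  have hh := abs_hessCount_le hL μ y f f'
  have ha := abs_linCount_le hL μ y f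
  have hb := abs_linCount_le hL μ y f'
  have h2d : (L : ℤ) ^ (2 * d) = (L : ℤ) ^ d * (L : ℤ) ^ d := by rw [two_mul, pow_add]
  have hi : |(if f = f' then linCount L μ y f else 0)| ≤ (L : ℤ) ^ d * ell d L := by
    split_ifs
    · exact ha
    · rw [abs_zero]; positivity
  rw [vhCount]
  have t1 := abs_sub (↑L ^ d * hessCount L μ y f f' + ↑L ^ d * (if f = f' then linCount L μ y f else 0))
    (linCount L μ y f * linCount L μ y f')
  have t2 := abs_add_le (↑L ^ d * hessCount L μ y f f') (↑L ^ d * (if f = f' then linCount L μ y f else 0))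
  rw [abs_mul, abs_mul, abs_of_nonneg (by positivity : (0 : ℤ) ≤ (L : ℤ) ^ d)] at t2
  rw [abs_mul] at t1
  have e1 : (L : ℤ) ^ d * |hessCount L μ y f f'| ≤ (L : ℤ) ^ d * (4 * (L : ℤ) ^ d * (ell d L : ℤ) ^ 2) :=
    mul_le_mul_of_nonneg_left hh (by positivity)
  have e2 : (L : ℤ) ^ d * |(if f = f' then linCount L μ y f else 0)| ≤ (L : ℤ) ^ d * ((L : ℤ) ^ d * ell d L) :=
    mul_le_mul_of_nonneg_left hi (by positivity)
  have e3 : |linCount L μ y f| * |linCount L μ y f'| ≤ ((L : ℤ) ^ d * ell d L) * ((L : ℤ) ^ d * ell d L) :=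
    mul_le_mul ha hb (abs_nonneg _) (by positivity)
  have e4 : (L : ℤ) ^ d * ((L : ℤ) ^ d * (ell d L : ℤ)) ≤ (L : ℤ) ^ d * ((L : ℤ) ^ d * (ell d L : ℤ) ^ 2) := by
    refine mul_le_mul_of_nonneg_left (mul_le_mul_of_nonneg_left ?_ (by positivity)) (by positivity)
    nlinarith
  rw [h2d]
  nlinarith

end Bounds

/-! ## §6 Block-translation covariance (the ONLY translation covariance of an averaging stencil) -/

section Covariance

variable {d : ℕ}

/-- [folklore] Translating a bond. -/
def Bond.sh (f : Bond d) (v : Fin d → ℤ) : Bond d := (f.1, f.2 + v)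

/-- [folklore] Shifting keeps the direction. -/
@[simp] theorem Bond.sh_fst (f : Bond d) (v : Fin d → ℤ) : (f.sh v).1 = f.1 := rfl
/-- [folklore] Shifting translates the base point. -/
@[simp] theorem Bond.sh_snd (f : Bond d) (v : Fin d → ℤ) : (f.sh v).2 = f.2 + v := rfl

/-- [folklore] Shifting bonds is injective. -/
theorem Bond.sh_inj {f f' : Bond d} {v : Fin d → ℤ} : f.sh v = f'.sh v ↔ f = f' := by
  constructor
  · intro h
    have h1 := congrArg Prod.fst h
    have h2 := congrArg Prod.snd h
    simp only [Bond.sh_fst, Bond.sh_snd, add_left_inj] at h1 h2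
    exact Prod.ext h1 h2
  · rintro rfl; rfl

/-- [folklore] node 5's `shift` of a shifted single-bond form. -/
theorem shift_single {𝔸 : Type*} [Zero 𝔸] (v : Fin d → ℤ) (f : Bond d) (w : 𝔸) :
    shift v (single (f.sh v) w) = single f w := by
  funext κ x
  simp only [shift, single_apply]
  have : ((κ, x + v) = f.sh v) ↔ ((κ, x) = f) := by
    constructor
    · intro h
      have h1 := congrArg Prod.fst h
      have h2 := congrArg Prod.snd h
      simp only [Bond.sh_fst, Bond.sh_snd, add_left_inj] at h1 h2
      exact Prod.ext h1 h2
    · rintro rfl; rfl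
  simp only [this]

/-- [folklore] node 5's `shift` of a shifted indicator. -/
theorem shift_δ1 (v : Fin d → ℤ) (f : Bond d) : shift v (δ1 (f.sh v)) = δ1 f := shift_single v f 1

/-- [folklore] `shift` commutes with `pairForm`. -/
theorem shift_pairForm {R : Type*} [AddCommGroup R] (v : Fin d → ℤ) (B A : Form1 d R) :
    shift v (pairForm B A) = pairForm (shift v B) (shift v A) := rfl

/-- [folklore] BLOCK COVARIANCE of `q¹`. -/
theorem linCount_add (L : ℕ) (μ : Fin d) (y t : Fin d → ℤ) (f : Bond d) :
    linCount L μ (y + t) (f.sh ((L : ℤ) • t)) = linCount L μ y f := by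
  rw [linCount, linAvg_add, shift_δ1, linCount]

/-- [folklore] Block-translation covariance of `cCount`. -/
theorem cCount_add (L : ℕ) (μ : Fin d) (y t : Fin d → ℤ) (f : Bond d) :
    cCount L μ (y + t) (f.sh ((L : ℤ) • t)) = cCount L μ y f := by
  rw [cCount, smul_add, segUp_add, shift_δ1, cCount]

/-- [folklore] BLOCK COVARIANCE of `h`. -/
theorem hessCount_add (L : ℕ) (μ : Fin d) (y t : Fin d → ℤ) (f f' : Bond d) :
    hessCount L μ (y + t) (f.sh ((L : ℤ) • t)) (f'.sh ((L : ℤ) • t)) = hessCount L μ y f f' := by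
  simp only [hessCount, loopC_add, smul_add, segUp_add, shift_pairForm, shift_δ1, linCount_add, cCount_add]

/-- [folklore] BLOCK COVARIANCE of `m`. -/
theorem vhCount_add (L : ℕ) (μ : Fin d) (y t : Fin d → ℤ) (f f' : Bond d) :
    vhCount L μ (y + t) (f.sh ((L : ℤ) • t)) (f'.sh ((L : ℤ) • t)) = vhCount L μ y f f' := by
  simp only [vhCount, hessCount_add, linCount_add, Bond.sh_inj]

end Covariance

/-! ## §7 The real kernels `q¹ = linCount/L^d`, `h = hessCount/(2L^d)`, `m = vhCount/(2L^{2d})` -/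

section RealKernels

variable {d : ℕ}

/-- [folklore] `q¹_b(f)`: the first-jet kernel of the one-step average (real, finite range). -/
noncomputable def linKer (L : ℕ) (μ : Fin d) (y : Fin d → ℤ) (f : Bond d) : ℝ := (linCount L μ y f : ℝ) / (L : ℝ) ^ d

/-- [folklore] `h_b(f, f′)`: the W-Hessian kernel of the one-step average at `U = 1` (real, finite range, antisymmetric). -/
noncomputable def hessKer (L : ℕ) (μ : Fin d) (y : Fin d → ℤ) (f f' : Bond d) : ℝ :=
  (hessCount L μ y f f' : ℝ) / (2 * (L : ℝ) ^ d)

/-- [folklore] `m_b(f, f′)`: the field–multiplier kernel in the product chart (real, finite range). -/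
noncomputable def vhKer (L : ℕ) (μ : Fin d) (y : Fin d → ℤ) (f f' : Bond d) : ℝ :=
  (vhCount L μ y f f' : ℝ) / (2 * (L : ℝ) ^ (2 * d))

/-- [folklore] ANTISYMMETRY of `hessKer`. -/
theorem hessKer_swap (L : ℕ) (μ : Fin d) (y : Fin d → ℤ) (f f' : Bond d) : hessKer L μ y f' f = -hessKer L μ y f f' := by
  rw [hessKer, hessKer, hessCount_swap, Int.cast_neg, neg_div]

/-- [folklore] `hessKer` vanishes when the first bond is off the support box. -/
theorem hessKer_eq_zero_left {L : ℕ} {μ : Fin d} {y : Fin d → ℤ} {f : Bond d} (h : ¬ Near L y f.2) (f' : Bond d) :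
    hessKer L μ y f f' = 0 := by rw [hessKer, hessCount_eq_zero_left h, Int.cast_zero, zero_div]

/-- [folklore] `hessKer` vanishes when the second bond is off the support box. -/
theorem hessKer_eq_zero_right {L : ℕ} {μ : Fin d} {y : Fin d → ℤ} (f : Bond d) {f' : Bond d} (h : ¬ Near L y f'.2) :
    hessKer L μ y f f' = 0 := by rw [hessKer, hessCount_eq_zero_right f h, Int.cast_zero, zero_div]

/-- [folklore] `vhKer` vanishes when the first bond is off the support box. -/
theorem vhKer_eq_zero_left {L : ℕ} {μ : Fin d} {y : Fin d → ℤ} {f : Bond d} (h : ¬ Near L y f.2) (f' : Bond d) :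
    vhKer L μ y f f' = 0 := by rw [vhKer, vhCount_eq_zero_left h, Int.cast_zero, zero_div]

/-- [folklore] `vhKer` vanishes when the second bond is off the support box. -/
theorem vhKer_eq_zero_right {L : ℕ} {μ : Fin d} {y : Fin d → ℤ} (f : Bond d) {f' : Bond d} (h : ¬ Near L y f'.2) :
    vhKer L μ y f f' = 0 := by rw [vhKer, vhCount_eq_zero_right f h, Int.cast_zero, zero_div]

/-- [folklore] `linKer` vanishes off the support box. -/
theorem linKer_eq_zero {L : ℕ} {μ : Fin d} {y : Fin d → ℤ} {f : Bond d} (h : ¬ Near L y f.2) : linKer L μ y f = 0 := by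
  rw [linKer, linCount_eq_zero h, Int.cast_zero, zero_div]

/-- [folklore] Block-translation covariance of `hessKer`. -/
theorem hessKer_add (L : ℕ) (μ : Fin d) (y t : Fin d → ℤ) (f f' : Bond d) :
    hessKer L μ (y + t) (f.sh ((L : ℤ) • t)) (f'.sh ((L : ℤ) • t)) = hessKer L μ y f f' := by
  rw [hessKer, hessKer, hessCount_add]

/-- [folklore] Block-translation covariance of `vhKer`. -/
theorem vhKer_add (L : ℕ) (μ : Fin d) (y t : Fin d → ℤ) (f f' : Bond d) :
    vhKer L μ (y + t) (f.sh ((L : ℤ) • t)) (f'.sh ((L : ℤ) • t)) = vhKer L μ y f f' := by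
  rw [vhKer, vhKer, vhCount_add]

/-- [folklore] Block-translation covariance of `linKer`. -/
theorem linKer_add (L : ℕ) (μ : Fin d) (y t : Fin d → ℤ) (f : Bond d) :
    linKer L μ (y + t) (f.sh ((L : ℤ) • t)) = linKer L μ y f := by
  rw [linKer, linKer, linCount_add]

/-- [folklore] `|h| ≤ 2ℓ²`. -/
theorem abs_hessKer_le {L : ℕ} (hL : 1 ≤ L) (μ : Fin d) (y : Fin d → ℤ) (f f' : Bond d) :
    |hessKer L μ y f f'| ≤ 2 * (ell d L : ℝ) ^ 2 := by
  have hLd : (0 : ℝ) < (L : ℝ) ^ d := by positivity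
  have h := abs_hessCount_le hL μ y f f'
  have h' : (|hessCount L μ y f f'| : ℝ) ≤ 4 * (L : ℝ) ^ d * (ell d L : ℝ) ^ 2 := by exact_mod_cast h
  rw [hessKer, abs_div, abs_of_pos (by positivity : (0 : ℝ) < 2 * (L : ℝ) ^ d), div_le_iff₀ (by positivity)]
  nlinarith

/-- [folklore] `|m| ≤ 3ℓ²`. -/
theorem abs_vhKer_le {L : ℕ} (hL : 1 ≤ L) (μ : Fin d) (y : Fin d → ℤ) (f f' : Bond d) :
    |vhKer L μ y f f'| ≤ 3 * (ell d L : ℝ) ^ 2 := by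
  have hLd : (0 : ℝ) < (L : ℝ) ^ (2 * d) := by positivity
  have h := abs_vhCount_le hL μ y f f'
  have h' : (|vhCount L μ y f f'| : ℝ) ≤ 6 * (L : ℝ) ^ (2 * d) * (ell d L : ℝ) ^ 2 := by exact_mod_cast h
  rw [vhKer, abs_div, abs_of_pos (by positivity : (0 : ℝ) < 2 * (L : ℝ) ^ (2 * d)), div_le_iff₀ (by positivity)]
  nlinarith

/-- [folklore] `|q¹| ≤ ℓ`. -/
theorem abs_linKer_le {L : ℕ} (hL : 1 ≤ L) (μ : Fin d) (y : Fin d → ℤ) (f : Bond d) :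
    |linKer L μ y f| ≤ (ell d L : ℝ) := by
  have hLd : (0 : ℝ) < (L : ℝ) ^ d := by positivity
  have h := abs_linCount_le hL μ y f
  have h' : (|linCount L μ y f| : ℝ) ≤ (L : ℝ) ^ d * (ell d L : ℝ) := by exact_mod_cast h
  rw [linKer, abs_div, abs_of_pos hLd, div_le_iff₀ hLd]
  nlinarith

end RealKernels

/-! ## §8 Packing into an2's index types: the stencil families `MKer (d+1) (Fib d)` -/

section Packing

variable {d : ℕ}

open ExpKernelCalculus (MKer BiLoc shiftK)
open OneStepResolventKernel (Fib LocStencil)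
open B12Sec2to5 (l1 l1_nonneg)

/-- [folklore] THE PACKER. A per-coarse-bond kernel family `K μ y (fluctuation bond) (background bond)` (node-5
conventions in dimension `d+1`) becomes a STENCIL FAMILY in the sense of an2's `LocStencil`: indexed by the
background fine bond `(κ′, u)`, the kernel `packVH K L κ′ u : MKer (d+1) (Fib d)` has entry
`((x, inl α), (z, inr μ)) ↦ K μ (z/L) (α, x) (κ′, u)` when `z ∈ L·ℤ^{d+1}` is the fine image of a coarse site (else `0`),
the symmetric twin on `(inr, inl)`, and `0` on the `(inl, inl)` / `(inr, inr)` blocks. -/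
noncomputable def packVH (K : Fin (d + 1) → (Fin (d + 1) → ℤ) → Bond (d + 1) → Bond (d + 1) → ℝ) (L : ℕ)
    (κ' : Fin (d + 1)) (u : Fin (d + 1) → ℤ) : MKer (d + 1) (Fib d) := fun x z a b =>
  match a, b with
  | Sum.inl α, Sum.inr μ => if off L z = 0 then K μ (blk L z) (α, x) (κ', u) else 0
  | Sum.inr μ, Sum.inl α => if off L x = 0 then K μ (blk L x) (α, z) (κ', u) else 0
  | Sum.inl _, Sum.inl _ => 0
  | Sum.inr _, Sum.inr _ => 0

variable (K : Fin (d + 1) → (Fin (d + 1) → ℤ) → Bond (d + 1) → Bond (d + 1) → ℝ)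

/-- [folklore] The `(inl, inr)` entries of the packer. -/
@[simp] theorem packVH_inl_inr (L : ℕ) (κ' : Fin (d + 1)) (u x z : Fin (d + 1) → ℤ) (α μ : Fin (d + 1)) :
    packVH K L κ' u x z (Sum.inl α) (Sum.inr μ) = if off L z = 0 then K μ (blk L z) (α, x) (κ', u) else 0 := rfl

/-- [folklore] The `(inr, inl)` entries of the packer. -/
@[simp] theorem packVH_inr_inl (L : ℕ) (κ' : Fin (d + 1)) (u x z : Fin (d + 1) → ℤ) (α μ : Fin (d + 1)) :
    packVH K L κ' u x z (Sum.inr μ) (Sum.inl α) = if off L x = 0 then K μ (blk L x) (α, z) (κ', u) else 0 := rfl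

/-- [folklore] The packer vanishes on the field–field block. -/
@[simp] theorem packVH_inl_inl (L : ℕ) (κ' : Fin (d + 1)) (u x z : Fin (d + 1) → ℤ) (α α' : Fin (d + 1)) :
    packVH K L κ' u x z (Sum.inl α) (Sum.inl α') = 0 := rfl

/-- [folklore] The packer vanishes on the multiplier–multiplier block. -/
@[simp] theorem packVH_inr_inr (L : ℕ) (κ' : Fin (d + 1)) (u x z : Fin (d + 1) → ℤ) (μ μ' : Fin (d + 1)) :
    packVH K L κ' u x z (Sum.inr μ) (Sum.inr μ') = 0 := rfl

/-- [folklore] The packed stencil is SYMMETRIC. -/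
theorem packVH_symm (L : ℕ) (κ' : Fin (d + 1)) (u x z : Fin (d + 1) → ℤ) (a b : Fib d) :
    packVH K L κ' u x z a b = packVH K L κ' u z x b a := by
  rcases a with α | μ <;> rcases b with α' | μ' <;> rfl

/-- [folklore] The coarse site `y` itself (its fine image `L·y`) lies in the support box. -/
theorem near_self {L : ℕ} (hL : 1 ≤ L) (y : Fin (d + 1) → ℤ) : Near L y ((L : ℤ) • y) := fun i => by
  simp only [Pi.smul_apply, smul_eq_mul]; constructor <;> omega

/-- [folklore] Two points of one support box are `ℓ¹`-close: `|x − u|₁ ≤ 2(d+1)L`. -/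
theorem l1_le_of_near {L : ℕ} {y x u : Fin (d + 1) → ℤ} (hx : Near L y x) (hu : Near L y u) :
    l1 (x - u) ≤ 2 * ((d : ℝ) + 1) * L := by
  unfold B12Sec2to5.l1
  have h : ∀ i ∈ (Finset.univ : Finset (Fin (d + 1))), |(((x - u) i : ℤ) : ℝ)| ≤ 2 * (L : ℝ) := by
    intro i _
    obtain ⟨h1, h2⟩ := hx i
    obtain ⟨h3, h4⟩ := hu i
    rw [Pi.sub_apply, ← Int.cast_abs]
    have : |x i - u i| ≤ 2 * (L : ℤ) := by rw [abs_le]; constructor <;> omega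
    exact_mod_cast this
  refine (Finset.sum_le_card_nsmul _ _ _ h).trans ?_
  rw [Finset.card_univ, Fintype.card_fin, nsmul_eq_mul]
  push_cast
  nlinarith

/-- [folklore] A fine point with zero offset is the fine image of its block index. -/
theorem eq_smul_blk_of_off_eq_zero {L : ℕ} (hL : 1 ≤ L) {z : Fin (d + 1) → ℤ} (hz : off L z = 0) :
    z = (L : ℤ) • blk L z := by
  have h := blk_add_off hL z
  have h0 : toSite (0 : Fin (d + 1) → ℕ) = 0 := toSite_zero
  rw [hz, h0, add_zero] at h
  exact h.symm

/-- [folklore] **A PACKED AVERAGING KERNEL FAMILY IS A LOCAL STENCIL FAMILY** (an2's `LocStencil`) for every rate `δ ≥ 0`,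
with constant `C · e^{4(d+1)Lδ}` — provided the family is supported in the support boxes and bounded by `C`. -/
theorem locStencil_packVH {L : ℕ} (hL : 1 ≤ L) {C : ℝ} (hC : 0 ≤ C)
    (h₁ : ∀ μ y f f', ¬ Near L y f.2 → K μ y f f' = 0) (h₂ : ∀ μ y f f', ¬ Near L y f'.2 → K μ y f f' = 0)
    (hb : ∀ μ y f f', |K μ y f f'| ≤ C) {δ : ℝ} (hδ : 0 ≤ δ) :
    LocStencil (packVH K L) (C * Real.exp (4 * ((d : ℝ) + 1) * L * δ)) δ := by
  intro κ' u x z a b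
  have hpos : 0 ≤ C * Real.exp (4 * ((d : ℝ) + 1) * L * δ) * Real.exp (-δ * (l1 (x - u) + l1 (z - u))) :=
    mul_nonneg (mul_nonneg hC (Real.exp_pos _).le) (Real.exp_pos _).le
  -- the generic estimate for a supported entry
  have key : ∀ (x z : Fin (d + 1) → ℤ) (μ α : Fin (d + 1)), off L z = 0 →
      |K μ (blk L z) (α, x) (κ', u)| ≤
        C * Real.exp (4 * ((d : ℝ) + 1) * L * δ) * Real.exp (-δ * (l1 (x - u) + l1 (z - u))) := by
    intro x z μ α hz
    have hpos' : 0 ≤ C * Real.exp (4 * ((d : ℝ) + 1) * L * δ) * Real.exp (-δ * (l1 (x - u) + l1 (z - u))) :=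
      mul_nonneg (mul_nonneg hC (Real.exp_pos _).le) (Real.exp_pos _).le
    by_cases hx : Near L (blk L z) x
    · by_cases hu : Near L (blk L z) u
      · have hz' : Near L (blk L z) z := by
          have h0 := near_self hL (blk L z)
          rwa [← eq_smul_blk_of_off_eq_zero hL hz] at h0
        have d1 := l1_le_of_near hx hu
        have d2 := l1_le_of_near hz' hu
        have hsum : δ * (l1 (x - u) + l1 (z - u)) ≤ 4 * ((d : ℝ) + 1) * L * δ := by nlinarith
        have h1 : 1 ≤ Real.exp (4 * ((d : ℝ) + 1) * L * δ) * Real.exp (-δ * (l1 (x - u) + l1 (z - u))) := by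
          rw [← Real.exp_add]; exact Real.one_le_exp (by linarith)
        calc |K μ (blk L z) (α, x) (κ', u)| ≤ C * 1 := by rw [mul_one]; exact hb _ _ _ _
          _ ≤ C * (Real.exp (4 * ((d : ℝ) + 1) * L * δ) * Real.exp (-δ * (l1 (x - u) + l1 (z - u)))) :=
              mul_le_mul_of_nonneg_left h1 hC
          _ = _ := by ring
      · rw [h₂ _ _ _ _ hu, abs_zero]; exact hpos'
    · rw [h₁ _ _ _ _ hx, abs_zero]; exact hpos'
  rcases a with α | μ <;> rcases b with α' | μ'
  · rw [packVH_inl_inl, abs_zero]; exact hpos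
  · rw [packVH_inl_inr]
    split_ifs with hz
    · exact key x z μ' α hz
    · rw [abs_zero]; exact hpos
  · rw [packVH_inr_inl]
    split_ifs with hx
    · rw [add_comm (l1 (x - u))]; exact key z x μ α' hx
    · rw [abs_zero]; exact hpos
  · rw [packVH_inr_inr, abs_zero]; exact hpos

/-- [folklore] Offsets are block-translation invariant. -/
theorem off_add_smul (L : ℕ) (z t : Fin (d + 1) → ℤ) : off L (z + (L : ℤ) • t) = off L z := by
  funext i
  simp only [off, Pi.add_apply, Pi.smul_apply, smul_eq_mul, Int.add_mul_emod_self_left]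

/-- [folklore] Block indices are block-translation covariant. -/
theorem blk_add_smul {L : ℕ} (hL : 1 ≤ L) (z t : Fin (d + 1) → ℤ) : blk L (z + (L : ℤ) • t) = blk L z + t := by
  funext i
  have hL0 : (L : ℤ) ≠ 0 := by omega
  simp only [blk, Pi.add_apply, Pi.smul_apply, smul_eq_mul, Int.add_mul_ediv_left _ _ hL0]

/-- [folklore] **BLOCK-TRANSLATION COVARIANCE OF A PACKED FAMILY** — the shape of an2's
`OneStepKernelFamily.vertexOfK_translate` hypothesis, for block translations `u ↦ u + L·t` ONLY. -/
theorem packVH_translate {L : ℕ} (hL : 1 ≤ L)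
    (hK : ∀ μ y t f f', K μ (y + t) (f.sh ((L : ℤ) • t)) (f'.sh ((L : ℤ) • t)) = K μ y f f')
    (κ' : Fin (d + 1)) (u t : Fin (d + 1) → ℤ) :
    packVH K L κ' (u + (L : ℤ) • t) = shiftK (-((L : ℤ) • t)) (packVH K L κ' u) := by
  funext x z a b
  simp only [shiftK]
  have e1 : ∀ w : Fin (d + 1) → ℤ, w + -((L : ℤ) • t) = w + (L : ℤ) • (-t) := fun w => by rw [smul_neg]
  rcases a with α | μ <;> rcases b with α' | μ'
  · rfl
  · rw [packVH_inl_inr, packVH_inl_inr, e1, e1, off_add_smul, blk_add_smul hL]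
    split_ifs with hz
    · have := hK μ' (blk L z + -t) t (α, x + (L : ℤ) • -t) (κ', u)
      rw [neg_add_cancel_right] at this
      rw [← this]
      congr 1; simp [Bond.sh, smul_neg]
    · rfl
  · rw [packVH_inr_inl, packVH_inr_inl, e1, e1, off_add_smul, blk_add_smul hL]
    split_ifs with hx
    · have := hK μ (blk L x + -t) t (α', z + (L : ℤ) • -t) (κ', u)
      rw [neg_add_cancel_right] at this
      rw [← this]
      congr 1; simp [Bond.sh, smul_neg]
    · rfl
  · rfl

/-! ### (b1) The field–multiplier stencil families: product chart `vhS`, additive chart `vhSadd` -/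

/-- [folklore] **(b1) THE FIELD–MULTIPLIER ((V-H)) STENCIL FAMILY IN THE PRODUCT CHART** `U = e^W e^B`: the packing
of `m_b = vhKer` — `vhS d L κ′ u x z (inl α) (inr μ) = m_{(μ, z/L)}((α, x), (κ′, u))` (fluctuation `(α, x)`, background
`(κ′, u)`, multiplier at the coarse bond `(μ, z/L)`), the letter-level kernel of `∂_{B_{(κ′,u)}} ∂_{W_{(α,x)}}
log[Φ_b(e^W e^B) Φ_b(e^B)⁻¹]` at `0` (identification: node 7b; nothing printed asserted). -/
noncomputable def vhS (d L : ℕ) : Fin (d + 1) → (Fin (d + 1) → ℤ) → MKer (d + 1) (Fib d) :=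
  packVH (fun μ y f f' => vhKer L μ y f f') L

/-- [folklore] **(b1′) THE FIELD–MULTIPLIER STENCIL FAMILY IN THE ADDITIVE CHART** `U = e^{W + B}`: the packing
of `h_b = hessKer` (the partial evaluation of the W-Hessian), same slots as `vhS`. -/
noncomputable def vhSadd (d L : ℕ) : Fin (d + 1) → (Fin (d + 1) → ℤ) → MKer (d + 1) (Fib d) :=
  packVH (fun μ y f f' => hessKer L μ y f f') L

/-- [folklore] `vhS` is symmetric. -/
theorem vhS_symm (L : ℕ) (κ' : Fin (d + 1)) (u x z : Fin (d + 1) → ℤ) (a b : Fib d) :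
    vhS d L κ' u x z a b = vhS d L κ' u z x b a := packVH_symm _ L κ' u x z a b

/-- [folklore] `vhSadd` is symmetric. -/
theorem vhSadd_symm (L : ℕ) (κ' : Fin (d + 1)) (u x z : Fin (d + 1) → ℤ) (a b : Fib d) :
    vhSadd d L κ' u x z a b = vhSadd d L κ' u z x b a := packVH_symm _ L κ' u x z a b

/-- [folklore] **`vhS` IS A LOCAL STENCIL FAMILY** for every `δ ≥ 0`, constant `3ℓ² · e^{4(d+1)Lδ}`, `ℓ = (2d+4)L`. -/
theorem locStencil_vhS {L : ℕ} (hL : 1 ≤ L) {δ : ℝ} (hδ : 0 ≤ δ) :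
    LocStencil (vhS d L) (3 * (ell (d + 1) L : ℝ) ^ 2 * Real.exp (4 * ((d : ℝ) + 1) * L * δ)) δ :=
  locStencil_packVH _ hL (by positivity) (fun _ _ _ f' h => vhKer_eq_zero_left h f')
    (fun _ _ f _ h => vhKer_eq_zero_right f h) (fun μ y f f' => abs_vhKer_le hL μ y f f') hδ

/-- [folklore] **`vhSadd` IS A LOCAL STENCIL FAMILY** for every `δ ≥ 0`, constant `2ℓ² · e^{4(d+1)Lδ}`. -/
theorem locStencil_vhSadd {L : ℕ} (hL : 1 ≤ L) {δ : ℝ} (hδ : 0 ≤ δ) :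
    LocStencil (vhSadd d L) (2 * (ell (d + 1) L : ℝ) ^ 2 * Real.exp (4 * ((d : ℝ) + 1) * L * δ)) δ :=
  locStencil_packVH _ hL (by positivity) (fun _ _ _ f' h => hessKer_eq_zero_left h f')
    (fun _ _ f _ h => hessKer_eq_zero_right f h) (fun μ y f f' => abs_hessKer_le hL μ y f f') hδ

/-- [folklore] Block-translation covariance of `vhS`. -/
theorem vhS_translate {L : ℕ} (hL : 1 ≤ L) (κ' : Fin (d + 1)) (u t : Fin (d + 1) → ℤ) :
    vhS d L κ' (u + (L : ℤ) • t) = shiftK (-((L : ℤ) • t)) (vhS d L κ' u) :=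
  packVH_translate _ hL (fun μ y t f f' => vhKer_add L μ y t f f') κ' u t

/-- [folklore] Block-translation covariance of `vhSadd`. -/
theorem vhSadd_translate {L : ℕ} (hL : 1 ≤ L) (κ' : Fin (d + 1)) (u t : Fin (d + 1) → ℤ) :
    vhSadd d L κ' (u + (L : ℤ) • t) = shiftK (-((L : ℤ) • t)) (vhSadd d L κ' u) :=
  packVH_translate _ hL (fun μ y t f f' => hessKer_add L μ y t f f') κ' u t

/-! ### (b2) The W-Hessian of the constraint per coarse bond, packed on the `(inl, inl)` block -/

/-- [folklore] **(b2) THE W-HESSIAN KERNEL OF THE COARSE BOND `b = (μ, y)`** (an2's `Q_b″`, letter level; identification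
node 7b) as an `MKer (d+1) (Fib d)` supported on the field–field block: entry
`((x, inl α), (x′, inl α′)) ↦ h_b((α, x), (α′, x′)) = hessKer L μ y (α, x) (α′, x′)`. -/
noncomputable def hessFF (L : ℕ) (μ : Fin (d + 1)) (y : Fin (d + 1) → ℤ) : MKer (d + 1) (Fib d) := fun x x' a b =>
  match a, b with
  | Sum.inl α, Sum.inl α' => hessKer L μ y (α, x) (α', x')
  | _, _ => 0

/-- [folklore] The field–field entries of `hessFF`. -/
@[simp] theorem hessFF_inl_inl (L : ℕ) (μ : Fin (d + 1)) (y x x' : Fin (d + 1) → ℤ) (α α' : Fin (d + 1)) :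
    hessFF L μ y x x' (Sum.inl α) (Sum.inl α') = hessKer L μ y (α, x) (α', x') := rfl

/-- [folklore] `hessFF` vanishes on `(inl, inr)`. -/
@[simp] theorem hessFF_inl_inr (L : ℕ) (μ : Fin (d + 1)) (y x x' : Fin (d + 1) → ℤ) (α μ' : Fin (d + 1)) :
    hessFF L μ y x x' (Sum.inl α) (Sum.inr μ') = 0 := rfl

/-- [folklore] `hessFF` vanishes on `(inr, ·)`. -/
@[simp] theorem hessFF_inr (L : ℕ) (μ : Fin (d + 1)) (y x x' : Fin (d + 1) → ℤ) (μ' : Fin (d + 1)) (b : Fib d) :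
    hessFF L μ y x x' (Sum.inr μ') b = 0 := by cases b <;> rfl

/-- [folklore] `hessFF` is ANTISYMMETRIC (the coefficient of a commutator). -/
theorem hessFF_antisymm (L : ℕ) (μ : Fin (d + 1)) (y x x' : Fin (d + 1) → ℤ) (a b : Fib d) :
    hessFF L μ y x' x b a = -hessFF L μ y x x' a b := by
  rcases a with α | ν <;> rcases b with α' | ν'
  · rw [hessFF_inl_inl, hessFF_inl_inl, hessKer_swap]
  all_goals simp

/-- [folklore] **`hessFF` IS BI-LOCALISED AT THE COARSE BOND** (at its fine image `L·y`) for every `δ ≥ 0`. -/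
theorem biLoc_hessFF {L : ℕ} (hL : 1 ≤ L) (μ : Fin (d + 1)) (y : Fin (d + 1) → ℤ) {δ : ℝ} (hδ : 0 ≤ δ) :
    BiLoc (hessFF L μ y) ((L : ℤ) • y) ((L : ℤ) • y)
      (2 * (ell (d + 1) L : ℝ) ^ 2 * Real.exp (4 * ((d : ℝ) + 1) * L * δ)) δ := by
  intro x x' a b
  have hpos : 0 ≤ 2 * (ell (d + 1) L : ℝ) ^ 2 * Real.exp (4 * ((d : ℝ) + 1) * L * δ) *
      Real.exp (-δ * (l1 (x - (L : ℤ) • y) + l1 (x' - (L : ℤ) • y))) := by positivity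
  rcases a with α | ν
  · rcases b with α' | ν'
    · rw [hessFF_inl_inl]
      by_cases hx : Near L y x
      · by_cases hx' : Near L y x'
        · have d1 := l1_le_of_near hx (near_self hL y)
          have d2 := l1_le_of_near hx' (near_self hL y)
          have hsum : δ * (l1 (x - (L : ℤ) • y) + l1 (x' - (L : ℤ) • y)) ≤ 4 * ((d : ℝ) + 1) * L * δ := by nlinarith
          have h1 : 1 ≤ Real.exp (4 * ((d : ℝ) + 1) * L * δ) *
              Real.exp (-δ * (l1 (x - (L : ℤ) • y) + l1 (x' - (L : ℤ) • y))) := by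
            rw [← Real.exp_add]; exact Real.one_le_exp (by linarith)
          have hb := abs_hessKer_le hL μ y (α, x) (α', x')
          calc |hessKer L μ y (α, x) (α', x')| ≤ 2 * (ell (d + 1) L : ℝ) ^ 2 * 1 := by rw [mul_one]; exact hb
            _ ≤ 2 * (ell (d + 1) L : ℝ) ^ 2 * (Real.exp (4 * ((d : ℝ) + 1) * L * δ) *
                  Real.exp (-δ * (l1 (x - (L : ℤ) • y) + l1 (x' - (L : ℤ) • y)))) :=
                mul_le_mul_of_nonneg_left h1 (by positivity)
            _ = _ := by ring
        · rw [hessKer_eq_zero_right _ hx', abs_zero]; exact hpos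
      · rw [hessKer_eq_zero_left hx, abs_zero]; exact hpos
    · rw [hessFF_inl_inr, abs_zero]; exact hpos
  · rw [hessFF_inr, abs_zero]; exact hpos

/-- [folklore] Block-translation covariance of `hessFF`. -/
theorem hessFF_translate {L : ℕ} (μ : Fin (d + 1)) (y t : Fin (d + 1) → ℤ) :
    hessFF L μ (y + t) = shiftK (-((L : ℤ) • t)) (hessFF L μ y) := by
  funext x x' a b
  simp only [shiftK]
  rcases a with α | ν
  · rcases b with α' | ν'
    · rw [hessFF_inl_inl, hessFF_inl_inl]
      have := hessKer_add L μ y t (α, x + -((L : ℤ) • t)) (α', x' + -((L : ℤ) • t))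
      rw [← this]
      congr 1 <;> simp [Bond.sh]
    · rfl
  · cases b <;> rfl

end Packing

/-! ## §9 (b3) Bałaban's (1.11) straight-contour family: bond multiplicities (for the Gram `Q′Q′ᵀ`) -/

section Straight

variable {d : ℕ}

/-- [folklore] `c_b(f)`: the MULTIPLICITY of the fine bond `f` in the (1.11) straight-contour family of the coarse bond
`b = (μ, y)` — the number of base points `x ∈ B(y)` whose straight contour `[x, x + L e_μ]` passes through `f`
(`= straightSum (δ1 f)` of node 5; the (1.11) average of a background form `A` is `L^{-(d+1)} Σ_f c_b(f) A(f)`). -/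
def straightCount (L : ℕ) (μ : Fin d) (y : Fin d → ℤ) (f : Bond d) : ℤ :=
  ∑ b ∈ box d L, (segUp (δ1 f) ((L : ℤ) • y + toSite b) μ L).sum

/-- [folklore] `straightCount` is node 5's `straightSum` of the indicator (definitionally). -/
theorem straightCount_eq_straightSum (L : ℕ) (μ : Fin d) (y : Fin d → ℤ) (f : Bond d) :
    straightCount L μ y f = straightSum (δ1 f) L μ y := rfl

/-- [folklore] DIRECTION SELECTION: the straight family of a `μ`-bond only sees `μ`-bonds. -/
theorem straightCount_eq_zero_of_fst_ne {L : ℕ} {μ : Fin d} (y : Fin d → ℤ) {f : Bond d} (h : f.1 ≠ μ) :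
    straightCount L μ y f = 0 := by
  refine Finset.sum_eq_zero fun b _ => List.sum_eq_zero fun a ha => ?_
  obtain ⟨s, _, rfl⟩ := mem_segUp ha
  rw [δ1_apply, if_neg]
  rintro rfl
  exact h rfl

/-- [folklore] The letters of a straight count are `0` or `1`. -/
theorem mem_segUp_δ1 {μ : Fin d} {z : Fin d → ℤ} {f : Bond d} {n : ℕ} {a : ℤ}
    (ha : a ∈ segUp (δ1 f) z μ n) : a = 0 ∨ a = 1 := by
  obtain ⟨s, _, rfl⟩ := mem_segUp ha
  rw [δ1_apply]
  split_ifs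
  · exact Or.inr rfl
  · exact Or.inl rfl

/-- [folklore] `0 ≤ c_b(f)`. -/
theorem straightCount_nonneg (L : ℕ) (μ : Fin d) (y : Fin d → ℤ) (f : Bond d) : 0 ≤ straightCount L μ y f :=
  Finset.sum_nonneg fun b _ => List.sum_nonneg fun a ha => by
    rcases mem_segUp_δ1 ha with h | h <;> simp [h]

/-- [folklore] Crude bound `c_b(f) ≤ L^d · L` (the sharp one is `≤ L`, attained in the middle of the block line). -/
theorem straightCount_le (L : ℕ) (μ : Fin d) (y : Fin d → ℤ) (f : Bond d) :
    straightCount L μ y f ≤ (L : ℤ) ^ d * L := by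
  unfold straightCount
  have h : ∀ b ∈ box d L, (segUp (δ1 f) ((L : ℤ) • y + toSite b) μ L).sum ≤ (L : ℤ) := by
    intro b _
    have h1 : ∀ a ∈ segUp (δ1 f) ((L : ℤ) • y + toSite b) μ L, a ≤ 1 := fun a ha => by
      rcases mem_segUp_δ1 ha with h | h <;> simp [h]
    refine (List.sum_le_card_nsmul _ 1 h1).trans ?_
    rw [nsmul_eq_mul, mul_one]
    unfold segUp; simp
  refine (Finset.sum_le_card_nsmul _ _ _ h).trans ?_
  have hcard : (box d L).card = L ^ d := by simp [AffineAveraging.box, Fintype.card_piFinset]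
  rw [hcard, nsmul_eq_mul]; push_cast; rfl

/-- [folklore] Block-translation covariance of the straight counts. -/
theorem straightCount_add (L : ℕ) (μ : Fin d) (y t : Fin d → ℤ) (f : Bond d) :
    straightCount L μ (y + t) (f.sh ((L : ℤ) • t)) = straightCount L μ y f := by
  unfold straightCount
  refine Finset.sum_congr rfl fun b _ => ?_
  rw [show (L : ℤ) • (y + t) + toSite b = ((L : ℤ) • y + toSite b) + (L : ℤ) • t by rw [smul_add]; abel,
    segUp_add, shift_δ1]

/-! ### Decided overlap profiles (d = 1): the straight families of ONE coarse bond OVERLAP along the block line.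
`c_L(s)` for the bond at `μ`-offset `s` from `L·y`: `L = 2 ↦ (1, 2, 1)`, `L = 3 ↦ (1, 2, 3, 2, 1)`; in general
`c_L(s) = min(s + 1, 2L − 1 − s)` for `0 ≤ s ≤ 2L − 2` (so the family reaches into the `μ`-NEIGHBOUR block), whence
(counting the `L^{d−1}` transverse positions) `Σ_f c_b(f)² = L^{d−1}·L(2L²+1)/3` and, for the `μ`-neighbour `b′ = (μ, y ± e_μ)`,
`Σ_f c_b(f) c_{b′}(f) = L^{d−1}·(L−1)L(L+1)/6`, all other pairs `0`: the Gram of the normalised (1.11) average is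
`Q′Q′ᵀ = L^{-(d+2)}·[((2L²+1)/3)·𝟙 + ((L²−1)/6)·(T_μ + T_μ⁻¹)]` on `μ`-bonds, with symbol `≥ L^{-(d+2)}(L²+2)/3 > 0`
— NOT a multiple of the identity (certified instances below; the general closed form is recorded, not kernel-proved). -/

example : straightCount 2 (0 : Fin 1) (fun _ => 0) (0, fun _ => 0) = 1 := by decide
example : straightCount 2 (0 : Fin 1) (fun _ => 0) (0, fun _ => 1) = 2 := by decide
example : straightCount 2 (0 : Fin 1) (fun _ => 0) (0, fun _ => 2) = 1 := by decide
example : straightCount 2 (0 : Fin 1) (fun _ => 0) (0, fun _ => 3) = 0 := by decide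
example : straightCount 2 (0 : Fin 1) (fun _ => 0) (0, fun _ => -1) = 0 := by decide
example : straightCount 3 (0 : Fin 1) (fun _ => 0) (0, fun _ => 0) = 1 := by decide
example : straightCount 3 (0 : Fin 1) (fun _ => 0) (0, fun _ => 1) = 2 := by decide
example : straightCount 3 (0 : Fin 1) (fun _ => 0) (0, fun _ => 2) = 3 := by decide
example : straightCount 3 (0 : Fin 1) (fun _ => 0) (0, fun _ => 3) = 2 := by decide
example : straightCount 3 (0 : Fin 1) (fun _ => 0) (0, fun _ => 4) = 1 := by decide
example : straightCount 3 (0 : Fin 1) (fun _ => 0) (0, fun _ => 5) = 0 := by decide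
/-- Gram numbers at `L = 2`, `d = 1`: `Σ c² = 1 + 4 + 1 = 6 = L(2L²+1)/3`, neighbour overlap `c(2)·c′(0) = 1·1 = 1 = (L−1)L(L+1)/6`. -/
example : straightCount 2 (0 : Fin 1) (fun _ => 1) (0, fun _ => 2) = 1 := by decide

end Straight

/-! ## §10 (b4) Composite (m-step) second jets: the chain rule, typed once -/

section Composite

/-- [folklore] A SECOND-ORDER JET AT `0` of a map normalised to vanish at `0`: additive first jet `lin` and a
two-argument second jet `bil` (no symmetry or additivity of `bil` is assumed — the recursion below needs none). -/
@[ext] structure Jet2 (V W : Type*) [AddCommGroup V] [AddCommGroup W] where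
  /-- the first jet -/
  lin : V →+ W
  /-- the second jet (polarised) -/
  bil : V → V → W

namespace Jet2

variable {V W X Y : Type*} [AddCommGroup V] [AddCommGroup W] [AddCommGroup X] [AddCommGroup Y]

/-- [folklore] The identity jet. -/
protected def id (V : Type*) [AddCommGroup V] : Jet2 V V := ⟨AddMonoidHom.id V, fun _ _ => 0⟩

/-- [folklore] **THE CHAIN RULE FOR SECOND JETS**: `(Φ ∘ Ψ)′ = Φ′Ψ′`, `(Φ ∘ Ψ)″[a, b] = Φ″[Ψ′a, Ψ′b] + Φ′(Ψ″[a, b])`. -/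
def comp (Φ : Jet2 W X) (Ψ : Jet2 V W) : Jet2 V X :=
  ⟨Φ.lin.comp Ψ.lin, fun a b => Φ.bil (Ψ.lin a) (Ψ.lin b) + Φ.lin (Ψ.bil a b)⟩

/-- [folklore] First jet of a composite. -/
@[simp] theorem comp_lin (Φ : Jet2 W X) (Ψ : Jet2 V W) (v : V) : (Φ.comp Ψ).lin v = Φ.lin (Ψ.lin v) := rfl

/-- [folklore] Second jet of a composite (the chain rule). -/
@[simp] theorem comp_bil (Φ : Jet2 W X) (Ψ : Jet2 V W) (a b : V) :
    (Φ.comp Ψ).bil a b = Φ.bil (Ψ.lin a) (Ψ.lin b) + Φ.lin (Ψ.bil a b) := rfl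

/-- [folklore] First jet of the identity. -/
@[simp] theorem id_lin (v : V) : (Jet2.id V).lin v = v := rfl

/-- [folklore] Second jet of the identity. -/
@[simp] theorem id_bil (a b : V) : (Jet2.id V).bil a b = 0 := rfl

/-- [folklore] Right unit law. -/
theorem comp_id (Φ : Jet2 V W) : Φ.comp (Jet2.id V) = Φ := by
  ext <;> simp

/-- [folklore] Left unit law. -/
theorem id_comp (Φ : Jet2 V W) : (Jet2.id W).comp Φ = Φ := by
  ext <;> simp

/-- [folklore] The chain rule is ASSOCIATIVE (so the m-fold composite jet does not depend on the bracketing). -/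
theorem comp_assoc (Θ : Jet2 X Y) (Φ : Jet2 W X) (Ψ : Jet2 V W) : (Θ.comp Φ).comp Ψ = Θ.comp (Φ.comp Ψ) := by
  ext <;> simp [map_add, add_assoc]

/-- [folklore] **THE m-STEP (HIERARCHICAL) COMPOSITE JET** `Q_m = Φ_{m−1} ∘ ⋯ ∘ Φ_0` of a sequence of one-step jets
(`Φ j` = the jet of the `(j+1)`-th averaging, acting on the output of the first `j`). -/
def iter (Φ : ℕ → Jet2 V V) : ℕ → Jet2 V V
  | 0 => Jet2.id V
  | m + 1 => (Φ m).comp (iter Φ m)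

/-- [folklore] `Q_0 = id`. -/
@[simp] theorem iter_zero (Φ : ℕ → Jet2 V V) : iter Φ 0 = Jet2.id V := rfl

/-- [folklore] `Q_{m+1} = Φ_m ∘ Q_m`. -/
theorem iter_succ (Φ : ℕ → Jet2 V V) (m : ℕ) : iter Φ (m + 1) = (Φ m).comp (iter Φ m) := rfl

/-- [folklore] **(b4) THE RECURSION** `Q_m″[a, b] = Φ″[Q_{m−1}′a, Q_{m−1}′b] + Φ′·Q_{m−1}″[a, b]`. -/
theorem iter_succ_bil (Φ : ℕ → Jet2 V V) (m : ℕ) (a b : V) :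
    (iter Φ (m + 1)).bil a b =
      (Φ m).bil ((iter Φ m).lin a) ((iter Φ m).lin b) + (Φ m).lin ((iter Φ m).bil a b) := rfl

/-- [folklore] First-jet half of the recursion (B9 (3.15) shape). -/
theorem iter_succ_lin (Φ : ℕ → Jet2 V V) (m : ℕ) (v : V) :
    (iter Φ (m + 1)).lin v = (Φ m).lin ((iter Φ m).lin v) := rfl

/-- [folklore] The linear transport from scale `j` through `n` further steps: `Φ_{j+n−1}′ ∘ ⋯ ∘ Φ_j′`. -/
def linFrom (Φ : ℕ → Jet2 V V) (j : ℕ) : ℕ → (V →+ V)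
  | 0 => AddMonoidHom.id V
  | n + 1 => (Φ (j + n)).lin.comp (linFrom Φ j n)

/-- [folklore] `linFrom Φ j 0 = id`. -/
@[simp] theorem linFrom_zero (Φ : ℕ → Jet2 V V) (j : ℕ) (v : V) : linFrom Φ j 0 v = v := rfl

/-- [folklore] The recursion of `linFrom`. -/
theorem linFrom_succ (Φ : ℕ → Jet2 V V) (j n : ℕ) (v : V) :
    linFrom Φ j (n + 1) v = (Φ (j + n)).lin (linFrom Φ j n v) := rfl

/-- [folklore] `Q_m′ = linFrom Φ 0 m`. -/
theorem iter_lin_eq_linFrom (Φ : ℕ → Jet2 V V) (m : ℕ) (v : V) : (iter Φ m).lin v = linFrom Φ 0 m v := by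
  induction m with
  | zero => rfl
  | succ m ih => rw [iter_succ_lin, linFrom_succ, Nat.zero_add, ih]

/-- [folklore] **(b4′) THE UNROLLED COMPOSITE SECOND JET**: a sum over the scale `j` at which the ONE-STEP second jet acts,
pre-composed with the composite first jets up to `j` and post-composed with the linear transport from `j+1` to `m`:
`Q_m″[a, b] = Σ_{j<m} (Φ_{m−1}′⋯Φ_{j+1}′)·Φ_j″[Q_j′a, Q_j′b]`. -/
theorem iter_bil_eq_sum (Φ : ℕ → Jet2 V V) (m : ℕ) (a b : V) :
    (iter Φ m).bil a b =
      ∑ j ∈ Finset.range m, linFrom Φ (j + 1) (m - 1 - j) ((Φ j).bil ((iter Φ j).lin a) ((iter Φ j).lin b)) := by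
  induction m with
  | zero => simp
  | succ m ih =>
    rw [iter_succ_bil, Finset.sum_range_succ, ih, map_sum]
    have h1 : linFrom Φ (m + 1) (m + 1 - 1 - m) = AddMonoidHom.id V := by
      rw [show m + 1 - 1 - m = 0 by omega]; rfl
    rw [h1, AddMonoidHom.id_apply, add_comm]
    congr 1
    refine Finset.sum_congr rfl fun j hj => ?_
    rw [Finset.mem_range] at hj
    rw [show m + 1 - 1 - j = (m - 1 - j) + 1 by omega, linFrom_succ,
      show j + 1 + (m - 1 - j) = m by omega]

end Jet2

end Composite

/-! ## §11 Decided toy tables (certificates of the sign / slot / normalisation conventions)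

`d = 1`, `y = 0`, bonds `c_s = (0, s)` (the `s`-th bond of the line through the origin):
* `L = 1` (trivial blocking): `q¹ = δ_{c₀}`, `h = 0`, `m = 0`;
* `L = 2`: `linCount = (2, 2, 0, …)` (`q¹ = linKer = 2/2 = 1` on the two bonds `c₀, c₁` of the block line; B7's (14)-normalised
  `Ā_b = q¹/L = ½`), `hessCount(c₀, c₁) = 2 = −hessCount(c₁, c₀)`
  (`h(c₀, c₁) = 2/(2·2) = ½`: `H(W, W′) = ½[W_{c₀}, W′_{c₁}]`-part), `vhCount(c₁, c₀) = −8`, all other entries `0`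
  (`m(c₁, c₀) = −8/(2·4) = −1`: `M(W; B) = [B_{c₀}, W_{c₁}]` — the fluctuation on the SECOND bond sees the background on the FIRST). -/

section Toy

example : linCount 1 (0 : Fin 1) (fun _ => 0) (0, fun _ => 0) = 1 := by decide
example : linCount 1 (0 : Fin 1) (fun _ => 0) (0, fun _ => 1) = 0 := by decide
example : hessCount 1 (0 : Fin 1) (fun _ => 0) (0, fun _ => 0) (0, fun _ => 1) = 0 := by decide
example : vhCount 1 (0 : Fin 1) (fun _ => 0) (0, fun _ => 0) (0, fun _ => 0) = 0 := by decide

example : linCount 2 (0 : Fin 1) (fun _ => 0) (0, fun _ => 0) = 2 := by decide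
example : linCount 2 (0 : Fin 1) (fun _ => 0) (0, fun _ => 1) = 2 := by decide
example : linCount 2 (0 : Fin 1) (fun _ => 0) (0, fun _ => 2) = 0 := by decide
example : linCount 2 (0 : Fin 1) (fun _ => 0) (0, fun _ => -1) = 0 := by decide
example : hessCount 2 (0 : Fin 1) (fun _ => 0) (0, fun _ => 0) (0, fun _ => 1) = 2 := by decide
example : hessCount 2 (0 : Fin 1) (fun _ => 0) (0, fun _ => 1) (0, fun _ => 0) = -2 := by decide
example : hessCount 2 (0 : Fin 1) (fun _ => 0) (0, fun _ => 0) (0, fun _ => 2) = 0 := by decide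
example : hessCount 2 (0 : Fin 1) (fun _ => 0) (0, fun _ => 1) (0, fun _ => 2) = 0 := by decide
example : vhCount 2 (0 : Fin 1) (fun _ => 0) (0, fun _ => 1) (0, fun _ => 0) = -8 := by decide
example : vhCount 2 (0 : Fin 1) (fun _ => 0) (0, fun _ => 0) (0, fun _ => 1) = 0 := by decide
example : vhCount 2 (0 : Fin 1) (fun _ => 0) (0, fun _ => 0) (0, fun _ => 0) = 0 := by decide
example : vhCount 2 (0 : Fin 1) (fun _ => 0) (0, fun _ => 1) (0, fun _ => 1) = 0 := by decide
example : vhCount 2 (0 : Fin 1) (fun _ => 0) (0, fun _ => 2) (0, fun _ => 1) = 0 := by decide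

end Toy
end Literature.MathematicalPhysics.QuantumFieldTheory.Balaban1983to89.Beta.AveragingHessianKernels
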